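import Literature.NumberTheory.LFunctions.TaoLogElliottCoreObjects
import Literature.NumberTheory.LFunctions.TaoLogElliottCoreBridge
import Literature.NumberTheory.LFunctions.TaoLogElliottCoreNumeric
import Literature.NumberTheory.LFunctions.TaoLogElliottBilinearPerturbation
import Literature.NumberTheory.LFunctions.TaoEntropyDecrementInSitu
import Literature.NumberTheory.LFunctions.TaoLogElliottHoeffding
import Literature.NumberTheory.LFunctions.TaoLogElliottShortSumExpectation
import Literature.NumberTheory.LFunctions.TaoLogElliottRestriction
import Literature.NumberTheory.LFunctions.TaoLogElliottPrimesP
import Literature.Probability.Entropy.EntropyDecoupling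
import HarnessLib

/-!
# Tao's log-averaged Elliott theorem: proof of the core of Theorem 2.3

This file discharges the named fact `Literature.NumberTheory.LFunctions.Tao2016_theorem23_core` (Tao, Forum Math. Pi 4 (2016)
e8, the proof of Theorem 2.3 from (2.10) on: §2 after Proposition 2.4, §3 and §4):
`Tao2016_theorem23_core_holds`.  It assembles the proof DAG

* Lemma 2.5 (`TaoLogElliottLogAvg.lean`), Proposition 2.6 (`TaoLogElliottProp26.lean`),
  (2.12) (`TaoLogElliottShortSumExpectation.lean`);
* the discretisation and the random variables `X_H`, `Y_H` (`TaoLogElliottDiscretisation.lean`,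
  `TaoLogElliottCoreObjects.lean`, `TaoLogElliottBilinearPerturbation.lean`, and
  `TaoLogElliottCoreBridge.lean` for `Trest(a𝐧) = F(X_H, Y_H)`, the display before Remark 2.7);
* the entropy decrement argument, Lemma 3.2 (`TaoEntropyDecrement.lean`,
  `TaoEntropyDecrementInSitu.lean`, `EntropyOfWindows.lean`, `TaoLogElliottWindowTI.lean`) and
  Lemmas 3.3–3.5 (`EntropyDecoupling.lean`, `TaoLogElliottHoeffding.lean`);
* Lemma 3.6 (`TaoLogElliottCircleMethod.lean`), Lemma 3.7 (`TaoLogElliottRestriction.lean`,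
  §4 via `ShiftedPrimePairs.lean`), the concluding paragraph (`TaoLogElliottEndgame.lean`) and
  the real-variable bookkeeping of the hierarchy of parameters (`TaoLogElliottCoreNumeric.lean`);
* the size of `𝒫_H` from the prime number theorem (`TaoLogElliottPrimesP.lean`).

## Contents
1. **The entropy steps at the concrete random variables** (`X_H = window (process (pairRound δ g₁ g₂) a) 0 H`,
   `Y_H = 𝐧 mod P_H` on `logSpace x ω` with weights `1/n`):
   `ent_process_pairRound_le` ((3.8)), `ent_mod_prod_primesP_le` ((3.10)),
   `condEnt_window_blocks_le` (the display before (3.12), from Lemma 2.5),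
   `exists_good_scale` (**Lemma 3.2** for `X_H, Y_H`: a scale with `𝐈(X_H : Y_H) ≤ c₀ H/log H`,
   (3.13)), `decoupling_bound` ((3.13) and Lemmas 3.3–3.5 ⇒ the decoupled lower bound, the
   display following the proof of Lemma 3.5).
2. **The chain at a good scale**, every error explicit: `scale_lower_bound`
   ((2.15) ⇒ `|𝔼 F(X_H,Y_H)|` ⇒ decoupled ⇒ undiscretised) and `endgame_bound` (Lemma 3.6 with
   (2.12): `κ' ≤ (6 + 3|h|)(ε² + #Ξ_H · a (B + 8 + 2 log a)/S)`).
3. **The theorem**: `scale_low`, `scale_contradiction` (at a good scale, (2.8) and (2.10) are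
   contradictory), `corrInd_lower_bound` ((2.8) ⇒ (2.14)), the normalisation `gᵢ(0) = 0`, and
   `Tao2016_theorem23_core_holds`.

The hierarchy of parameters of the paper (`ε`; then `H₋` large depending on `a, b, h, ε`; then
`H₊` large depending on `H₋`; then `A` large depending on `H₊`) is realised by explicit
thresholds: `ε₁ = min(1/27648, ε/(256 a (6|h| + 286)))` is the "`ε` shrunk depending on
`a, b, h`" of Proposition 2.6 (used for `𝒫_H`, the mesh `ε₁²` of the discretisation, the sets
`E_x`, `Ξ_H`), `H₋` comes from finitely many `∀ᶠ H` statements, `H₊` from Lemma 3.2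
(`exists_good_scale`), and `A₀ = exp(S₀ + 1)` where `S₀(H₊, …)` bounds the harmonic sum
`S = ∑_{x/ω<n≤x} 1/n ≥ log ω - 1` from below.

## References
* T. Tao, Forum Math. Pi 4 (2016), e8; arXiv:1509.05422, §2 (from the remark after
  Proposition 2.4: (2.8), (2.10), (2.12), (2.14), (2.15), the display before Remark 2.7), §3
  ((3.8), (3.10), the displays before (3.12), (3.13), Lemmas 3.2–3.7, the two displays following
  the proof of Lemma 3.5, the concluding paragraph) and §4.
-/

open Finset Real Complex Filter

namespace Literature.NumberTheory.LFunctions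

namespace Tao2016

open Literature.Probability.LatticeModels Literature.Probability.Entropy.FiniteShannon

/-! ## Part 1. The entropy steps at the concrete random variables -/

/-! ### (3.8) and (3.10) -/

/-- **Tao 2016, (3.8)**: each coordinate `(g_{1,δ}(a𝐧+j), g_{2,δ}(a𝐧+j))` of `X_H` takes values in
the finite alphabet `alphabet × alphabet`, so has entropy `≤ log #alphabet²` ("each `g_{i,ε²}`
takes `O_ε(1)` values, hence `𝐇(X_H) ≪_ε H`"). [cite: TaoFMP2016, §3 (3.8)] -/
theorem ent_process_pairRound_le {δ : ℝ} (hδ : 0 < δ) {g₁ g₂ : ℕ → ℂ} (hb₁ : ∀ n, ‖g₁ n‖ ≤ 1)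
    (hb₂ : ∀ n, ‖g₂ n‖ ≤ 1) (a : ℕ) (x ω : ℝ) (j : ℕ) :
    ent (logSpace x ω) logWeight (process (pairRound δ g₁ g₂) a j) ≤
      Real.log #(meshAlphabet δ ×ˢ meshAlphabet δ) :=
  ent_le_log_card (logWeight_nonneg x ω) (image_subset_iff.2 fun _ _ => pairRound_mem hδ hb₁ hb₂ _)

/-- `1 ≤ #alphabet²`. [folklore] -/
theorem one_le_card_meshAlphabet_sq {δ : ℝ} (hδ : 0 < δ) :
    1 ≤ #(meshAlphabet δ ×ˢ meshAlphabet δ) := by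
  rw [Nat.one_le_iff_ne_zero, ← Nat.pos_iff_ne_zero, card_pos]
  exact ⟨_, pairRound_mem hδ (g₁ := fun _ => 0) (g₂ := fun _ => 0) (by simp) (by simp) 0⟩

/-- **Tao 2016, (3.10)**: `𝐇(Y_H) ≤ log P_H ≤ ⌊ε²H⌋ log 4 ≤ 2H` (`Y_H = 𝐧 mod P_H`, uniform bound
plus `P_H ≤ 4^{ε²H}`). [cite: TaoFMP2016, §3 (3.10)] -/
theorem ent_mod_prod_primesP_le {ε : ℝ} (hε1 : ε ≤ 1) (hε0 : 0 ≤ ε) (H : ℕ) (x ω : ℝ) :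
    ent (logSpace x ω) logWeight (fun n => n % ∏ p ∈ primesP ε H, p) ≤ 2 * H := by
  have hP := prod_primesP_pos ε H
  refine (ent_mod_le_log hP x ω).trans ?_
  have h1 : ((∏ p ∈ primesP ε H, p : ℕ) : ℝ) ≤ (4 : ℝ) ^ ⌊ε ^ 2 * H⌋₊ := by
    exact_mod_cast prod_primesP_le_four_pow ε H
  have h2 : (⌊ε ^ 2 * H⌋₊ : ℝ) ≤ H := by
    have h3 : ε ^ 2 * H ≤ H := by
      have : ε ^ 2 ≤ 1 := pow_le_one₀ hε0 hε1
      nlinarith [(Nat.cast_nonneg H : (0 : ℝ) ≤ H)]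
    exact (Nat.floor_le (by positivity)).trans h3
  have hlog4 : Real.log 4 ≤ 2 := by
    have := Real.log_two_lt_d9
    rw [show (4 : ℝ) = 2 ^ 2 by norm_num, Real.log_pow]; push_cast; linarith
  calc Real.log ((∏ p ∈ primesP ε H, p : ℕ) : ℝ) ≤ Real.log ((4 : ℝ) ^ ⌊ε ^ 2 * H⌋₊) :=
        Real.log_le_log (by exact_mod_cast hP) h1
    _ = ⌊ε ^ 2 * H⌋₊ * Real.log 4 := by rw [Real.log_pow]
    _ ≤ H * 2 := mul_le_mul h2 hlog4 (Real.log_nonneg (by norm_num)) (Nat.cast_nonneg _)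
    _ = 2 * H := by ring

/-! ### Approximate translation invariance of the conditional block entropies -/

/-- **Tao 2016, the display before (3.12), for the concrete process** (from Lemma 2.5 through
`Literature.NumberTheory.LFunctions.Tao2016.condEnt_window_shift_le`): if `a m = j H`, `m ≤ H₊`, `H ≤ H₊`, `P ≤ 4^{H₊}`,
`4 H₊ ≤ S = ∑_{x/ω<n≤x} 1/n`, then
`𝐇(X_{jH,(j+1)H} | 𝐧 mod P) ≤ 𝐇(X_{0,H} | 𝐧 mod P) + #alphabet^{2H₊} 4^{H₊} · 3 √(4H₊/S)`.
[cite: TaoFMP2016, §3 (display before (3.12)) and Lemma 2.5] -/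
theorem condEnt_window_blocks_le {δ : ℝ} (hδ : 0 < δ) {g₁ g₂ : ℕ → ℂ} (hb₁ : ∀ n, ‖g₁ n‖ ≤ 1)
    (hb₂ : ∀ n, ‖g₂ n‖ ≤ 1) {a H j m P Hp : ℕ} (hP : 0 < P) (hm : a * m = j * H) (hmHp : m ≤ Hp)
    (hHHp : H ≤ Hp) (hPle : P ≤ 4 ^ Hp) {x ω : ℝ} (hS : 0 < logWeightSum x ω)
    (h4 : 4 * (Hp : ℝ) ≤ logWeightSum x ω) :
    condEnt (logSpace x ω) logWeight (window (process (pairRound δ g₁ g₂) a) (j * H) H)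
        (fun n => n % P) ≤
      condEnt (logSpace x ω) logWeight (window (process (pairRound δ g₁ g₂) a) 0 H) (fun n => n % P) +
        ((#(meshAlphabet δ ×ˢ meshAlphabet δ) ^ Hp * 4 ^ Hp : ℕ) : ℝ) *
          (3 * Real.sqrt (4 * Hp / logWeightSum x ω)) := by
  set V := meshAlphabet δ ×ˢ meshAlphabet δ with hV
  set S := logWeightSum x ω with hSdef
  set t : Finset (List (ℂ × ℂ) × ℕ) := windowSet V H ×ˢ range P with ht
  have hmem : ∀ n : ℕ, (window (process (pairRound δ g₁ g₂) a) 0 H n, n % P) ∈ t := fun n =>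
    mem_product.2 ⟨window_process_pairRound_mem hδ hb₁ hb₂ a 0 H n, mem_range.2 (Nat.mod_lt _ hP)⟩
  have ht1 : (logSpace x ω).image (fun n => (window (process (pairRound δ g₁ g₂) a) 0 H n, n % P)) ⊆ t :=
    image_subset_iff.2 fun n _ => hmem n
  have ht2 : (logSpace x ω).image
      (fun n => (window (process (pairRound δ g₁ g₂) a) 0 H (n + m), (n + m) % P)) ⊆ t :=
    image_subset_iff.2 fun n _ => hmem (n + m)
  have hmS : 4 * (m : ℝ) ≤ S := le_trans (by gcongr) h4
  have h1 := condEnt_window_shift_le (pairRound δ g₁ g₂) hP hm hS hmS ht1 ht2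
  refine h1.trans (add_le_add le_rfl ?_)
  -- bound the error term
  have hu0 : 0 ≤ 4 * (m : ℝ) / S := by positivity
  have hu1 : 4 * (m : ℝ) / S ≤ 1 := by
    rw [div_le_one hS]; linarith
  have hcard : (#t : ℝ) ≤ ((#V ^ Hp * 4 ^ Hp : ℕ) : ℝ) := by
    have hV1 : 1 ≤ #V := one_le_card_meshAlphabet_sq hδ
    have : #t ≤ #V ^ Hp * 4 ^ Hp := by
      rw [ht, card_product, card_range]
      exact Nat.mul_le_mul ((card_windowSet_le V H).trans (Nat.pow_le_pow_right hV1 hHHp)) hPle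
    exact_mod_cast this
  have hφ : negMulLog (4 * m / S) + 4 * m / S ≤ 3 * Real.sqrt (4 * Hp / S) :=
    (Numeric.negMulLog_add_le hu0 hu1).trans (by gcongr)
  have hφ0 : 0 ≤ negMulLog (4 * m / S) + 4 * m / S := add_nonneg (negMulLog_nonneg hu0 hu1) hu0
  calc (#t : ℝ) * (negMulLog (4 * m / S) + 4 * m / S)
      ≤ ((#V ^ Hp * 4 ^ Hp : ℕ) : ℝ) * (negMulLog (4 * m / S) + 4 * m / S) :=
        mul_le_mul_of_nonneg_right hcard hφ0
    _ ≤ ((#V ^ Hp * 4 ^ Hp : ℕ) : ℝ) * (3 * Real.sqrt (4 * Hp / S)) :=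
        mul_le_mul_of_nonneg_left hφ (by positivity)

/-! ### Lemma 3.2 for `X_H`, `Y_H` -/

/-- **Tao 2016, Lemma 3.2 for the concrete random variables.**  Let `a ≥ 1`, `H₋`, `δ > 0` (the
mesh), `c₀ > 0`.  There is `H₊₀` (depending only on these) such that for all `H₊ ≥ H₊₀`, all
`0 < ε ≤ 1`, every range `x/ω < n ≤ x` with `S = ∑ 1/n ≥ 4H₊` and
`H₊ · #alphabet^{2H₊} 4^{H₊} · 3√(4H₊/S) ≤ 1` (i.e. `A` large depending on `H₊`, Lemma 2.5), and all
`1`-bounded `g₁, g₂`, there is a scale `H ∈ [H₋, H₊]`, `a ∣ H`, `H ≥ 16`, with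
`𝐈(X_H : Y_H) ≤ c₀ H / log H`, `Y_H = 𝐧 mod P_H`, `P_H = ∏_{p ∈ 𝒫_H} p`.
[cite: TaoFMP2016, Lemma 3.2 and the remark following it] -/
theorem exists_good_scale (a : ℕ) (ha : 1 ≤ a) (Hm : ℕ) {δ c₀ : ℝ} (hδ : 0 < δ) (hc₀ : 0 < c₀) :
    ∃ Hp₀ : ℕ, ∀ Hp : ℕ, Hp₀ ≤ Hp → ∀ ε : ℝ, 0 < ε → ε ≤ 1 →
      ∀ x ω : ℝ, 0 < logWeightSum x ω → 4 * (Hp : ℝ) ≤ logWeightSum x ω →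
        (Hp : ℝ) * (((#(meshAlphabet δ ×ˢ meshAlphabet δ) ^ Hp * 4 ^ Hp : ℕ) : ℝ) *
          (3 * Real.sqrt (4 * Hp / logWeightSum x ω))) ≤ 1 →
        ∀ g₁ g₂ : ℕ → ℂ, (∀ n, ‖g₁ n‖ ≤ 1) → (∀ n, ‖g₂ n‖ ≤ 1) →
          ∃ H : ℕ, Hm ≤ H ∧ H ≤ Hp ∧ a ∣ H ∧ 16 ≤ H ∧
            mutualInfo (logSpace x ω) logWeight (window (process (pairRound δ g₁ g₂) a) 0 H)
              (fun n => n % ∏ p ∈ primesP ε H, p) ≤ c₀ * H / Real.log H := by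
  set V := meshAlphabet δ ×ˢ meshAlphabet δ with hV
  have hV1 : 1 ≤ #V := one_le_card_meshAlphabet_sq hδ
  have hlogV : 0 ≤ Real.log #V := Real.log_nonneg (by exact_mod_cast hV1)
  set C : ℝ := Real.log #V + 3 with hC
  have hC1 : 1 ≤ C := by rw [hC]; linarith
  obtain ⟨Hp₀, hmain⟩ := exists_scale_mutualInfo_le (ι := ℕ) (α := ℂ × ℂ) a ha Hm hC1 hc₀
  refine ⟨Hp₀, fun Hp hHp ε hε hε1 x ω hS h4 hsmall g₁ g₂ hb₁ hb₂ => ?_⟩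
  have hw := logWeight_nonneg x ω
  refine hmain Hp hHp (logSpace x ω) logWeight hw (process (pairRound δ g₁ g₂) a)
    (fun H n => n % ∏ p ∈ primesP ε H, p) (fun j => ?_) (fun H _ _ => ?_) _ (by positivity) hsmall
    (fun H j _ haH hjH => ?_)
  · -- (3.8)
    exact (ent_process_pairRound_le hδ hb₁ hb₂ a x ω j).trans (by rw [hC]; linarith)
  · -- (3.10)
    refine (ent_mod_prod_primesP_le hε1 hε.le H x ω).trans ?_
    rw [hC]
    nlinarith [(Nat.cast_nonneg H : (0 : ℝ) ≤ H)]
  · -- translation invariance along the blocks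
    have hHHp : H ≤ Hp := le_trans (Nat.le_mul_of_pos_left H (Nat.succ_pos j)) hjH
    obtain ⟨m, hm⟩ : a ∣ j * H := Dvd.dvd.mul_left haH j
    have hm' : a * m = j * H := hm.symm
    have hmHp : m ≤ Hp := by
      have : m ≤ a * m := Nat.le_mul_of_pos_left m ha
      have h2 : j * H ≤ Hp := le_trans (Nat.mul_le_mul_right H (Nat.le_succ j)) hjH
      omega
    have hP := prod_primesP_pos ε H
    have hPle : ∏ p ∈ primesP ε H, p ≤ 4 ^ Hp := by
      refine (prod_primesP_le_four_pow ε H).trans (Nat.pow_le_pow_right (by norm_num) ?_)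
      refine le_trans ?_ hHHp
      have h3 : ε ^ 2 * H ≤ H := by
        have : ε ^ 2 ≤ 1 := pow_le_one₀ hε.le hε1
        nlinarith [(Nat.cast_nonneg H : (0 : ℝ) ≤ H)]
      exact Nat.floor_le_of_le (by exact_mod_cast h3)
    exact condEnt_window_blocks_le hδ hb₁ hb₂ hP hm' hmHp hHHp hPle hS h4

/-! ### The decoupling step: (3.13) ⇒ the decoupled lower bound -/

/-- `|𝔼 Z| ≤ 𝔼 |Z|` in the weighted form used by `EntropyDecoupling.lean`. [folklore] -/
theorem norm_logAvg_le_avg_norm (Z : ℕ → ℂ) {x ω : ℝ} (hS : 0 < logWeightSum x ω) :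
    ‖logAvg Z x ω‖ ≤ (∑ n ∈ logSpace x ω, logWeight n * ‖Z n‖) / logWeightSum x ω := by
  unfold logAvg wsum
  rw [norm_div, Complex.norm_real, Real.norm_of_nonneg hS.le]
  refine div_le_div_of_nonneg_right ((norm_sum_le _ _).trans (le_of_eq
    (sum_congr rfl fun n _ => ?_))) hS.le
  rw [norm_div, Complex.norm_natCast]
  unfold logWeight
  rw [div_eq_inv_mul]

/-- **Tao 2016, (3.13) ⇒ the decoupled lower bound, at a good scale.**  Let `0 < ε ≤ 1/27648`, `ε⁴H ≥ 4`,
`ε⁷H/log H ≥ 2`, `a < ε²H/2`, `|c_p| ≤ 1` on `𝒫_H`, `0 < δ ≤ 1`, `|gᵢ| ≤ 1`, and on the range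
`x/ω < n ≤ x` let `𝐇(Y_H) ≥ log P_H - η` ((3.9)) and `𝐈(X_H : Y_H) ≤ κ` ((3.13)).  Then, with the
rounded rows `x̃ᵢ(𝐧) = (g_{i,δ}(a𝐧 + j))_j` (`seqAt (roundTo δ gᵢ) (a𝐧)`),
`|𝔼 F(x̃(𝐧), 𝐧 mod P_H) - 𝔼 ∑_{p ∈ 𝒫_H} (c_p/p) ∑_j 1_{j ≡ pb (a)} x̃_{1,j}(𝐧) x̃_{2,j+ph}(𝐧)|`
`≤ ε²H/log H + D ((log 2 + η + τ)/(ε⁷H/log H) + (κ + η)/τ)` for every `τ > 0`, where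
`D = ∑_{p ∈ 𝒫_H} (4(H/p + 1) + 4H/p)` bounds `|F| + |∑_p mean F_p|`; this is Lemma 3.3 with
Hoeffding's Lemma 3.5 supplying the concentration hypothesis (Lemma 3.4); in the paper this is
the passage "From Lemma 3.3 and Lemma 3.5 we have `F(X_H, Y_H) - (1/P_H)∑_y F(X_H, y) ≪ ε² H/log H`
with probability `1 - o(1)` …" after the proof of Lemma 3.5.
[cite: TaoFMP2016, §3 ((3.13), Lemmas 3.3–3.5 and the display following the proof of Lemma 3.5)] -/
theorem decoupling_bound {a H : ℕ} (ha : 0 < a) (b h : ℤ) {ε : ℝ} (hε : 0 < ε)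
    (hε0 : ε ≤ 1 / 27648) (hH : 4 ≤ ε ^ 4 * H) (hH2 : 2 ≤ ε ^ 7 * H / Real.log H)
    (haε : (a : ℝ) < ε ^ 2 * H / 2) (c : ℕ → ℂ) (hc : ∀ p ∈ primesP ε H, ‖c p‖ ≤ 1)
    {δ : ℝ} (hδ : 0 < δ) (hδ1 : δ ≤ 1) {g₁ g₂ : ℕ → ℂ} (hb₁ : ∀ n, ‖g₁ n‖ ≤ 1)
    (hb₂ : ∀ n, ‖g₂ n‖ ≤ 1) {x ω : ℝ} (hS : 0 < logWeightSum x ω) {κ η τ : ℝ} (hτ : 0 < τ)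
    (hent : Real.log ((∏ p ∈ primesP ε H, p : ℕ) : ℝ) - η ≤
      ent (logSpace x ω) logWeight (fun n => n % ∏ p ∈ primesP ε H, p))
    (hI : mutualInfo (logSpace x ω) logWeight (window (process (pairRound δ g₁ g₂) a) 0 H)
      (fun n => n % ∏ p ∈ primesP ε H, p) ≤ κ) :
    ‖logAvg (fun n => Fbil a H b h c (seqAt (roundTo δ g₁) (a * n)) (seqAt (roundTo δ g₂) (a * n))
          (primesP ε H) ((n : ZMod (∏ p ∈ primesP ε H, p)))) x ω -
        logAvg (fun n => bilinC H a b h (primesP ε H) c (seqAt (roundTo δ g₁) (a * n))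
          (seqAt (roundTo δ g₂) (a * n))) x ω‖ ≤
      ε ^ 2 * H / Real.log H +
        (∑ p ∈ primesP ε H, (4 * ((H : ℝ) / p + 1) + 4 * ((H : ℝ) / p))) *
          ((Real.log 2 + η + τ) / (ε ^ 7 * H / Real.log H) + (κ + η) / τ) := by
  set Pr := primesP ε H with hPr
  set P : ℕ := ∏ p ∈ Pr, p with hPdef
  have hP : 0 < P := prod_primesP_pos ε H
  haveI : NeZero P := ⟨hP.ne'⟩
  set s := logSpace x ω with hs
  set X : ℕ → List (ℂ × ℂ) := window (process (pairRound δ g₁ g₂) a) 0 H with hX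
  set Y : ℕ → ℕ := fun n => n % P with hY
  set D : ℝ := ∑ p ∈ Pr, (4 * ((H : ℝ) / p + 1) + 4 * ((H : ℝ) / p)) with hD
  set lam : ℝ := ε ^ 2 * H / Real.log H with hlam
  set θ : ℝ := ε ^ 7 * H / Real.log H with hθ
  have hPr0 : ∀ p ∈ Pr, 0 < p := fun p hp => (prime_of_mem_primesP hp).pos
  have hD0 : 0 ≤ D := sum_nonneg fun p _ => by positivity
  have hθ0 : 0 < θ := by rw [hθ]; linarith
  have hε1 : ε ≤ 1 := hε0.trans (by norm_num)
  have hH4 : (4 : ℝ) ≤ H := by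
    nlinarith [hH, pow_le_one₀ hε.le hε1 (n := 4), (Nat.cast_nonneg H : (0 : ℝ) ≤ H)]
  have hlogH : 0 < Real.log H := Real.log_pos (by linarith)
  have hlam0 : 0 ≤ lam := by rw [hlam]; positivity
  have hw := logWeight_nonneg x ω
  have hmass : 0 < mass s logWeight := by rw [hs, mass_logSpace]; exact hS
  -- the rows read from a word, and the truncated distance `d`
  set d : List (ℂ × ℂ) → ℕ → ℝ := fun l y => min D
    ‖Fbil a H b h c (lseq Prod.fst l) (lseq Prod.snd l) Pr ((y : ZMod P)) -
      bilinC H a b h Pr c (lseq Prod.fst l) (lseq Prod.snd l)‖ with hd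
  have hdD : ∀ l y, d l y ≤ D := fun l y => min_le_left _ _
  have hT : s.image Y ⊆ range P := image_mod_subset_range hP _
  have hent' : Real.log #(range P) - η ≤ ent s logWeight Y := by rwa [card_range]
  -- rows of actual windows are `2`-bounded
  have hδ2 : 1 + δ ≤ 2 := by linarith
  have hx₁ : ∀ n, ∀ j ∈ Icc (1 : ℤ) H, ‖lseq Prod.fst (X n) j‖ ≤ 2 := fun n j _ =>
    (norm_lseq_window_le hδ hb₁ hb₂ a H n j).1.trans hδ2
  have hx₂ : ∀ n, ∀ j ∈ Icc (1 : ℤ) H, ‖lseq Prod.snd (X n) j‖ ≤ 2 := fun n j _ =>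
    (norm_lseq_window_le hδ hb₁ hb₂ a H n j).2.trans hδ2
  -- concentration (Lemma 3.4 via Lemma 3.5)
  have hconc : ∀ l ∈ s.image X,
      (#((range P).filter fun y => lam ≤ d l y) : ℝ) ≤ Real.exp (-θ) * #(range P) := by
    intro l hl
    obtain ⟨n₀, -, rfl⟩ := mem_image.1 hl
    have h35 := lemma35 ha b h hε hε0 hH hH2 haε c hc (lseq Prod.fst (X n₀)) (lseq Prod.snd (X n₀))
      (hx₁ n₀) (hx₂ n₀) (P := P) hPdef
    rw [card_range]
    refine le_trans ?_ h35
    have hsub : (range P).filter (fun y => lam ≤ d (X n₀) y) ⊆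
        (range P).filter (fun y : ℕ => lam ≤
          ‖Fbil a H b h c (lseq Prod.fst (X n₀)) (lseq Prod.snd (X n₀)) Pr ((y : ZMod P)) -
            bilinC H a b h Pr c (lseq Prod.fst (X n₀)) (lseq Prod.snd (X n₀))‖) := by
      intro y hy
      rw [mem_filter] at hy ⊢
      exact ⟨hy.1, hy.2.trans (min_le_right _ _)⟩
    have h2 := card_filter_range_natCast_le (P := P) (fun z : ZMod P => lam ≤
      ‖Fbil a H b h c (lseq Prod.fst (X n₀)) (lseq Prod.snd (X n₀)) Pr z -
        bilinC H a b h Pr c (lseq Prod.fst (X n₀)) (lseq Prod.snd (X n₀))‖)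
    exact_mod_cast (card_le_card hsub).trans h2
  -- Lemma 3.3 packaged
  have hmain := wsum_div_mass_le_of_mutualInfo_le hw hmass X Y hT d hD0 hdD hθ0 hτ hlam0 hent' hI hconc
  -- identify the left-hand side
  have hrow₁ : ∀ n, ∀ j ∈ Icc (1 : ℤ) H, lseq Prod.fst (X n) j = seqAt (roundTo δ g₁) (a * n) j :=
    fun n => lseq_window_fst δ g₁ g₂ a H n
  have hrow₂ : ∀ n, ∀ j ∈ Icc (1 : ℤ) H, lseq Prod.snd (X n) j = seqAt (roundTo δ g₂) (a * n) j :=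
    fun n => lseq_window_snd δ g₁ g₂ a H n
  have hsx₁ : ∀ n, ∀ j ∈ Icc (1 : ℤ) H, ‖seqAt (roundTo δ g₁) (a * n) j‖ ≤ 2 := fun n j hj => by
    rw [← hrow₁ n j hj]; exact hx₁ n j hj
  have hsx₂ : ∀ n, ∀ j ∈ Icc (1 : ℤ) H, ‖seqAt (roundTo δ g₂) (a * n) j‖ ≤ 2 := fun n j hj => by
    rw [← hrow₂ n j hj]; exact hx₂ n j hj
  set F : ℕ → ℂ := fun n => Fbil a H b h c (seqAt (roundTo δ g₁) (a * n))
    (seqAt (roundTo δ g₂) (a * n)) Pr ((n : ZMod P)) with hF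
  set G : ℕ → ℂ := fun n => bilinC H a b h Pr c (seqAt (roundTo δ g₁) (a * n))
    (seqAt (roundTo δ g₂) (a * n)) with hG
  have hFG : ∀ n, ‖F n - G n‖ ≤ D := by
    intro n
    refine (norm_sub_le _ _).trans ?_
    have h1 := norm_Fbil_le_sum (a := a) (b := b) (h := h) (c := c) hPr0 (by norm_num : (0:ℝ) ≤ 2)
      (by norm_num : (0:ℝ) ≤ 2) (hsx₁ n) (hsx₂ n) ((n : ZMod P))
    have h2 := norm_bilinC_le_sum (a := a) (b := b) (h := h) (c := c) hPr0 (by norm_num : (0:ℝ) ≤ 2)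
      (by norm_num : (0:ℝ) ≤ 2) (hsx₁ n) (hsx₂ n)
    rw [hD, sum_add_distrib]
    refine add_le_add (h1.trans (sum_le_sum fun p hp => ?_)) (h2.trans (sum_le_sum fun p hp => ?_))
    · have : 0 ≤ (H : ℝ) / p + 1 := by positivity
      calc ‖c p‖ * (2 * 2 * ((H : ℝ) / p + 1)) ≤ 1 * (2 * 2 * ((H : ℝ) / p + 1)) :=
            mul_le_mul_of_nonneg_right (hc p hp) (by positivity)
        _ = 4 * ((H : ℝ) / p + 1) := by ring
    · calc ‖c p‖ * (2 * 2 * ((H : ℝ) / p)) ≤ 1 * (2 * 2 * ((H : ℝ) / p)) :=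
            mul_le_mul_of_nonneg_right (hc p hp) (by positivity)
        _ = 4 * ((H : ℝ) / p) := by ring
  have hdXY : ∀ n, d (X n) (Y n) = ‖F n - G n‖ := by
    intro n
    rw [hd]
    simp only
    rw [Fbil_congr (hrow₁ n) (hrow₂ n), bilinC_congr (hrow₁ n) (hrow₂ n), hY]
    simp only
    rw [ZMod.natCast_mod, min_eq_right (hFG n)]
  have hlhs : ‖logAvg F x ω - logAvg G x ω‖ ≤
      (∑ n ∈ s, logWeight n * d (X n) (Y n)) / mass s logWeight := by
    rw [← logAvg_sub, hs, mass_logSpace]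
    refine (norm_logAvg_le_avg_norm _ hS).trans (le_of_eq ?_)
    congr 1
    exact sum_congr rfl fun n _ => by rw [hdXY]
  exact hlhs.trans hmain

/-! ## Part 2. The argument at a good scale `H` -/

/-- Basic facts on `𝒫_H` under the standing size conditions: primes, `∤ a`, `≤ H`, nonempty,
dividing `P_H`. [folklore] -/
theorem primesP_facts {a H : ℕ} (ha : 1 ≤ a) {ε : ℝ} (hε : 0 < ε) (hε1 : ε ≤ 1)
    (hH : 4 ≤ ε ^ 4 * H) (haε : (a : ℝ) < ε ^ 2 * H / 2) :
    (∀ p ∈ primesP ε H, p.Prime ∧ ¬p ∣ a ∧ p ≤ H) ∧ (primesP ε H).Nonempty ∧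
      (∀ p ∈ primesP ε H, p ∣ ∏ q ∈ primesP ε H, q) := by
  have hε2 : ε ^ 2 ≤ 1 := pow_le_one₀ hε.le hε1
  have hε4 : ε ^ 4 ≤ 1 := pow_le_one₀ hε.le hε1
  have hH4 : (4 : ℝ) ≤ H := by nlinarith [(Nat.cast_nonneg H : (0 : ℝ) ≤ H)]
  refine ⟨fun p hp => ?_, primesP_nonempty (by nlinarith), fun p hp => dvd_prod_of_mem _ hp⟩
  obtain ⟨hpr, hlo, hhi⟩ := mem_primesP.1 hp
  refine ⟨hpr, fun hpa => ?_, ?_⟩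
  · have h1 : (p : ℝ) ≤ a := by exact_mod_cast Nat.le_of_dvd (by omega) hpa
    linarith
  · have h1 : (p : ℝ) ≤ H := hhi.trans (by nlinarith [(Nat.cast_nonneg H : (0 : ℝ) ≤ H)])
    exact_mod_cast h1

set_option maxHeartbeats 800000 in
/-- **The chain (2.15) ⇒ `|𝔼 F(X_H,Y_H)|` ⇒ decoupled ⇒ undiscretised, with explicit errors.**
Standing data: `g₁, g₂` completely multiplicative, unimodular on `ℕ₊`, `1`-bounded; `a ≥ 1`,
`b`, `h`; `0 < ε ≤ 1/27648`; a scale `H ≥ 16`, `H ≥ a`, with `ε⁴H ≥ 4`, `ε⁷H/log H ≥ 2`,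
`a < ε²H/2`, `∑_{p ∈ 𝒫_H} 1/p ≥ 1/(4 log H)`; a range with `S = ∑_{x/ω<n≤x} 1/n > 0` and
`x/ω ≥ |h| + 1`; entropy data `𝐇(Y_H) ≥ log P_H - η`, `𝐈(X_H : Y_H) ≤ κ` (mesh `δ = ε²`),
`η, κ ≥ 0`, `τ > 0`; and `0 ≤ X ≤ |𝔼 1_{𝐧 ≡ b (a)} g₁(𝐧) g₂(𝐧+h)|`.  Then
`|𝔼 ∑_{p∈𝒫_H} (c_p/p) ∑_{j ≡ pb (a)} g₁(a𝐧+j) g₂(a𝐧+j+ph)| ≥ H X/(4 log H) - 6a²/log H`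
`- 6|h| ε² H/log H - (a² + 2aH + 2|h|H)(3ε²H/log H)(4H + 2 log H + 12)/S - 46 ε² H/log H`
`- (60 H/log H)((log 2 + η + τ)/(ε⁷H/log H) + (κ + η)/τ)`.
[cite: TaoFMP2016, §2 (2.15) and §3 ((3.13) and the two displays following the proof of Lemma 3.5)] -/
theorem scale_lower_bound {g₁ g₂ : ℕ → ℂ}
    (hcm₁ : ∀ m n : ℕ, 1 ≤ m → 1 ≤ n → g₁ (m * n) = g₁ m * g₁ n)
    (hcm₂ : ∀ m n : ℕ, 1 ≤ m → 1 ≤ n → g₂ (m * n) = g₂ m * g₂ n)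
    (hS₁ : ∀ n : ℕ, 1 ≤ n → ‖g₁ n‖ = 1) (hS₂ : ∀ n : ℕ, 1 ≤ n → ‖g₂ n‖ = 1)
    (hb₁ : ∀ n, ‖g₁ n‖ ≤ 1) (hb₂ : ∀ n, ‖g₂ n‖ ≤ 1)
    {a : ℕ} (ha : 1 ≤ a) (b h : ℤ) {ε : ℝ} (hε : 0 < ε) (hε0 : ε ≤ 1 / 27648)
    {H : ℕ} (h16 : 16 ≤ H) (haH : a ≤ H) (hH : 4 ≤ ε ^ 4 * H)
    (hH2 : 2 ≤ ε ^ 7 * H / Real.log H) (haε : (a : ℝ) < ε ^ 2 * H / 2)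
    (hσ : 1 / (4 * Real.log H) ≤ ∑ p ∈ primesP ε H, 1 / (p : ℝ))
    {x ω : ℝ} (hS : 0 < logWeightSum x ω) (hrange : (h.natAbs : ℝ) + 1 ≤ x / ω)
    {κ η τ : ℝ} (hκ : 0 ≤ κ) (hη : 0 ≤ η) (hτ : 0 < τ)
    (hent : Real.log ((∏ p ∈ primesP ε H, p : ℕ) : ℝ) - η ≤
      ent (logSpace x ω) logWeight (fun n => n % ∏ p ∈ primesP ε H, p))
    (hI : mutualInfo (logSpace x ω) logWeight (window (process (pairRound (ε ^ 2) g₁ g₂) a) 0 H)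
      (fun n => n % ∏ p ∈ primesP ε H, p) ≤ κ)
    {X : ℝ} (hX0 : 0 ≤ X) (hX : X ≤ ‖logAvg (corrInd a b h g₁ g₂) x ω‖) :
    H * X / (4 * Real.log H) - 6 * a ^ 2 / Real.log H - 6 * h.natAbs * ε ^ 2 * H / Real.log H -
        ((a : ℝ) ^ 2 + 2 * a * H + 2 * h.natAbs * H) * (3 * (ε ^ 2 * H) / Real.log H) *
          ((4 * H + 2 * Real.log H + 12) / logWeightSum x ω) -
        46 * ε ^ 2 * H / Real.log H -
        60 * H / Real.log H *
          ((Real.log 2 + η + τ) / (ε ^ 7 * H / Real.log H) + (κ + η) / τ) ≤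
      ‖logAvg (fun n => bilinC H a b h (primesP ε H) (cCoeff g₁ g₂) (seqAt g₁ (a * n))
        (seqAt g₂ (a * n))) x ω‖ := by
  -- notation and basic sizes
  set Pr := primesP ε H with hPr
  set P : ℕ := ∏ p ∈ Pr, p with hPdef
  set L : ℝ := Real.log H with hL
  set S : ℝ := logWeightSum x ω with hSdef
  set σ : ℝ := ∑ p ∈ Pr, 1 / (p : ℝ) with hσdef
  set c : ℕ → ℂ := cCoeff g₁ g₂ with hc
  have ha0 : 0 < a := ha
  have hε1 : ε ≤ 1 := hε0.trans (by norm_num)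
  have hδ0 : 0 < ε ^ 2 := by positivity
  have hδ1 : ε ^ 2 ≤ 1 := pow_le_one₀ hε.le hε1
  have hHR : (16 : ℝ) ≤ H := by exact_mod_cast h16
  have hH0 : (0 : ℝ) < H := by linarith
  have hL0 : 0 < L := Real.log_pos (by linarith)
  have hLH : L ≤ H := (Real.log_le_sub_one_of_pos hH0).trans (by linarith)
  obtain ⟨hPr3, hne, hdvd⟩ := primesP_facts ha hε hε1 hH haε
  have hPr2 : ∀ p ∈ Pr, p.Prime ∧ ¬p ∣ a := fun p hp => ⟨(hPr3 p hp).1, (hPr3 p hp).2.1⟩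
  have hPr0 : ∀ p ∈ Pr, 0 < p := fun p hp => (hPr3 p hp).1.pos
  have hcb : ∀ p ∈ Pr, ‖c p‖ ≤ 1 := fun p _ => norm_cCoeff_le hb₁ hb₂ p
  obtain ⟨hcard, hσ6⟩ := card_primesP_le hε hε1 hH
  rw [← hPr] at hcard hσ6
  rw [← hσdef] at hσ6
  have hσ0 : 0 ≤ σ := sum_nonneg fun p _ => by positivity
  have hcard0 : (0 : ℝ) ≤ #Pr := Nat.cast_nonneg _
  -- rows
  have hx₁ : ∀ n, ∀ j ∈ Icc (1 : ℤ) H, ‖seqAt g₁ (a * n) j‖ ≤ 1 := fun n j _ => hb₁ _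
  have hx₂ : ∀ n, ∀ j ∈ Icc (1 : ℤ) H, ‖seqAt g₂ (a * n) j‖ ≤ 1 := fun n j _ => hb₂ _
  have hy₁ : ∀ n, ∀ j ∈ Icc (1 : ℤ) H, ‖seqAt (roundTo (ε ^ 2) g₁) (a * n) j‖ ≤ 2 := fun n j _ =>
    (norm_seqAt_round_le hδ0 hb₁ (a * n) j).trans (by linarith)
  have hy₂ : ∀ n, ∀ j ∈ Icc (1 : ℤ) H, ‖seqAt (roundTo (ε ^ 2) g₂) (a * n) j‖ ≤ 2 := fun n j _ =>
    (norm_seqAt_round_le hδ0 hb₂ (a * n) j).trans (by linarith)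
  have hd₁ : ∀ n, ∀ j ∈ Icc (1 : ℤ) H, ‖seqAt g₁ (a * n) j - seqAt (roundTo (ε ^ 2) g₁) (a * n) j‖ ≤ ε ^ 2 :=
    fun n j _ => norm_seqAt_sub_seqAt_round_le hδ0 g₁ (a * n) j
  have hd₂ : ∀ n, ∀ j ∈ Icc (1 : ℤ) H, ‖seqAt g₂ (a * n) j - seqAt (roundTo (ε ^ 2) g₂) (a * n) j‖ ≤ ε ^ 2 :=
    fun n j _ => norm_seqAt_sub_seqAt_round_le hδ0 g₂ (a * n) j
  have hd₁' : ∀ n, ∀ j ∈ Icc (1 : ℤ) H, ‖seqAt (roundTo (ε ^ 2) g₁) (a * n) j - seqAt g₁ (a * n) j‖ ≤ ε ^ 2 :=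
    fun n j hj => by rw [norm_sub_rev]; exact hd₁ n j hj
  have hd₂' : ∀ n, ∀ j ∈ Icc (1 : ℤ) H, ‖seqAt (roundTo (ε ^ 2) g₂) (a * n) j - seqAt g₂ (a * n) j‖ ≤ ε ^ 2 :=
    fun n j hj => by rw [norm_sub_rev]; exact hd₂ n j hj
  -- the four random variables
  set F : ℕ → ℂ := fun n => Fbil a H b h c (seqAt g₁ (a * n)) (seqAt g₂ (a * n)) Pr ((n : ZMod P))
    with hF
  set Ft : ℕ → ℂ := fun n => Fbil a H b h c (seqAt (roundTo (ε ^ 2) g₁) (a * n))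
    (seqAt (roundTo (ε ^ 2) g₂) (a * n)) Pr ((n : ZMod P)) with hFt
  set Gt : ℕ → ℂ := fun n => bilinC H a b h Pr c (seqAt (roundTo (ε ^ 2) g₁) (a * n))
    (seqAt (roundTo (ε ^ 2) g₂) (a * n)) with hGt
  set G : ℕ → ℂ := fun n => bilinC H a b h Pr c (seqAt g₁ (a * n)) (seqAt g₂ (a * n)) with hG
  -- (2.15): Proposition 2.6
  have h26 := prop26 hcm₁ hcm₂ hS₁ hS₂ hb₁ hb₂ ha0 h16 haH hPr3 hne b h hS hrange (x := x) (ω := ω)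
  rw [← hσdef, ← hSdef, ← hL] at h26
  -- `Trest(a n) = F(n)` (the display before Remark 2.7)
  have h31 : logAvg (fun n => Trest a b h g₁ g₂ Pr H (a * n)) x ω = logAvg F x ω := by
    congr 1
    funext n
    rw [hF]
    exact Trest_mul_eq_Fbil b h hPr2 H n hdvd
  rw [h31] at h26
  -- discretisation of `F`
  have hdisc : ‖logAvg F x ω - logAvg Ft x ω‖ ≤ 3 * ε ^ 2 * (H * σ + #Pr) := by
    rw [← logAvg_sub]
    refine norm_logAvg_le hS fun n _ => ?_
    refine (norm_Fbil_sub_Fbil_le (a := a) (b := b) (h := h) (c := c) hPr0 (by norm_num : (0:ℝ) ≤ 1)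
      (by norm_num : (0:ℝ) ≤ 2) hδ0.le hδ0.le (hx₁ n) (hy₂ n) (hd₁ n) (hd₂ n) _).trans ?_
    calc ∑ p ∈ Pr, ‖c p‖ * ((1 * ε ^ 2 + ε ^ 2 * 2) * ((H : ℝ) / p + 1))
        ≤ ∑ p ∈ Pr, 1 * ((1 * ε ^ 2 + ε ^ 2 * 2) * ((H : ℝ) / p + 1)) :=
          sum_le_sum fun p hp => mul_le_mul_of_nonneg_right (hcb p hp) (by positivity)
      _ = ∑ p ∈ Pr, (3 * ε ^ 2 * H * (1 / (p : ℝ)) + 3 * ε ^ 2) := sum_congr rfl fun p _ => by ring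
      _ = 3 * ε ^ 2 * H * σ + 3 * ε ^ 2 * #Pr := by
          rw [sum_add_distrib, sum_const, nsmul_eq_mul, hσdef, mul_sum]
          ring
      _ = 3 * ε ^ 2 * (H * σ + #Pr) := by ring
  -- decoupling
  have hdec := decoupling_bound ha0 b h hε hε0 hH hH2 haε c hcb hδ0 hδ1 hb₁ hb₂ hS hτ hent hI
  rw [← hPr, ← hL] at hdec
  have hD : (∑ p ∈ Pr, (4 * ((H : ℝ) / p + 1) + 4 * ((H : ℝ) / p))) = 8 * H * σ + 4 * #Pr := by
    calc (∑ p ∈ Pr, (4 * ((H : ℝ) / p + 1) + 4 * ((H : ℝ) / p)))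
        = ∑ p ∈ Pr, (8 * H * (1 / (p : ℝ)) + 4) := sum_congr rfl fun p _ => by ring
      _ = 8 * H * σ + 4 * #Pr := by
          rw [sum_add_distrib, sum_const, nsmul_eq_mul, hσdef, mul_sum]
          ring
  rw [hD] at hdec
  -- undoing the discretisation in the local means
  have hund : ‖logAvg Gt x ω - logAvg G x ω‖ ≤ 3 * ε ^ 2 * (H * σ) := by
    rw [← logAvg_sub]
    refine norm_logAvg_le hS fun n _ => ?_
    refine (norm_bilinC_sub_bilinC_le (a := a) (b := b) (h := h) (c := c) hPr0 (by norm_num : (0:ℝ) ≤ 2)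
      (by norm_num : (0:ℝ) ≤ 1) hδ0.le hδ0.le (hy₁ n) (hx₂ n) (hd₁' n) (hd₂' n)).trans ?_
    calc ∑ p ∈ Pr, ‖c p‖ * ((2 * ε ^ 2 + ε ^ 2 * 1) * ((H : ℝ) / p))
        ≤ ∑ p ∈ Pr, 1 * ((2 * ε ^ 2 + ε ^ 2 * 1) * ((H : ℝ) / p)) :=
          sum_le_sum fun p hp => mul_le_mul_of_nonneg_right (hcb p hp) (by positivity)
      _ = ∑ p ∈ Pr, 3 * ε ^ 2 * H * (1 / (p : ℝ)) := sum_congr rfl fun p _ => by ring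
      _ = 3 * ε ^ 2 * (H * σ) := by rw [hσdef, ← mul_assoc, mul_sum]
  -- the triangle inequality chain
  have htri : ‖logAvg F x ω‖ ≤ ‖logAvg G x ω‖ + ‖logAvg F x ω - logAvg Ft x ω‖ +
      ‖logAvg Ft x ω - logAvg Gt x ω‖ + ‖logAvg Gt x ω - logAvg G x ω‖ := by
    have h1 : ‖logAvg F x ω‖ ≤ ‖logAvg G x ω‖ + ‖logAvg F x ω - logAvg G x ω‖ :=
      norm_le_insert' _ _
    have h2 : ‖logAvg F x ω - logAvg G x ω‖ ≤
        ‖logAvg F x ω - logAvg Ft x ω‖ + ‖logAvg Ft x ω - logAvg G x ω‖ :=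
      norm_sub_le_norm_sub_add_norm_sub _ _ _
    have h3 : ‖logAvg Ft x ω - logAvg G x ω‖ ≤
        ‖logAvg Ft x ω - logAvg Gt x ω‖ + ‖logAvg Gt x ω - logAvg G x ω‖ :=
      norm_sub_le_norm_sub_add_norm_sub _ _ _
    linarith only [h1, h2, h3]
  -- numeric simplifications of the error terms
  set X₀ := ‖logAvg (corrInd a b h g₁ g₂) x ω‖ with hX₀
  have hmainX : H * X / (4 * L) ≤ H * σ * X₀ := by
    calc H * X / (4 * L) = H * (1 / (4 * L)) * X := by ring
      _ ≤ H * σ * X₀ := by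
          refine mul_le_mul (mul_le_mul_of_nonneg_left hσ hH0.le) hX hX0 (by positivity)
  have haR : (1 : ℝ) ≤ a := by exact_mod_cast ha
  have hhabs : (0 : ℝ) ≤ h.natAbs := Nat.cast_nonneg _
  have he1 : (a : ℝ) ^ 2 * σ ≤ 6 * a ^ 2 / L := by
    calc (a : ℝ) ^ 2 * σ ≤ a ^ 2 * (6 / L) := mul_le_mul_of_nonneg_left hσ6 (by positivity)
      _ = 6 * a ^ 2 / L := by ring
  have he2 : 2 * (h.natAbs : ℝ) * #Pr ≤ 6 * h.natAbs * ε ^ 2 * H / L := by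
    calc 2 * (h.natAbs : ℝ) * #Pr ≤ 2 * h.natAbs * (3 * (ε ^ 2 * H) / L) :=
          mul_le_mul_of_nonneg_left hcard (by positivity)
      _ = 6 * h.natAbs * ε ^ 2 * H / L := by ring
  have he3 : ((a : ℝ) ^ 2 + 2 * a * H + 2 * h.natAbs * H) * #Pr * ((4 * H + 2 * L + 12) / S) ≤
      ((a : ℝ) ^ 2 + 2 * a * H + 2 * h.natAbs * H) * (3 * (ε ^ 2 * H) / L) *
        ((4 * H + 2 * L + 12) / S) := by
    have h1 : 0 ≤ (4 * H + 2 * L + 12) / S := by positivity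
    have h2 : 0 ≤ (a : ℝ) ^ 2 + 2 * a * H + 2 * h.natAbs * H := by positivity
    exact mul_le_mul_of_nonneg_right (mul_le_mul_of_nonneg_left hcard h2) h1
  have he4 : 3 * ε ^ 2 * (H * σ + #Pr) ≤ 27 * (ε ^ 2 * H / L) := by
    have h1 : H * σ + #Pr ≤ H * (6 / L) + 3 * (ε ^ 2 * H) / L :=
      add_le_add (mul_le_mul_of_nonneg_left hσ6 hH0.le) hcard
    have h2 : H * (6 / L) + 3 * (ε ^ 2 * H) / L ≤ 9 * H / L := by
      rw [show H * (6 / L) + 3 * (ε ^ 2 * H) / L = (6 + 3 * ε ^ 2) * H / L by ring]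
      refine div_le_div_of_nonneg_right ?_ hL0.le
      have h9 : 6 + 3 * ε ^ 2 ≤ 9 := by linarith only [pow_le_one₀ hε.le hε1 (n := 2)]
      exact mul_le_mul_of_nonneg_right h9 hH0.le
    calc 3 * ε ^ 2 * (H * σ + #Pr) ≤ 3 * ε ^ 2 * (9 * H / L) :=
          mul_le_mul_of_nonneg_left (h1.trans h2) (by positivity)
      _ = 27 * (ε ^ 2 * H / L) := by ring
  have he5 : 3 * ε ^ 2 * (H * σ) ≤ 18 * (ε ^ 2 * H / L) := by
    calc 3 * ε ^ 2 * (H * σ) ≤ 3 * ε ^ 2 * (H * (6 / L)) :=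
          mul_le_mul_of_nonneg_left (mul_le_mul_of_nonneg_left hσ6 hH0.le) (by positivity)
      _ = 18 * (ε ^ 2 * H / L) := by ring
  have h46 : 46 * ε ^ 2 * H / L = 46 * (ε ^ 2 * H / L) := by ring
  have hQ0 : 0 ≤ (Real.log 2 + η + τ) / (ε ^ 7 * H / L) + (κ + η) / τ := by
    have : 0 < Real.log 2 := Real.log_pos (by norm_num)
    have hθ : 0 < ε ^ 7 * H / L := by positivity
    positivity
  have he6 : (8 * H * σ + 4 * #Pr) * ((Real.log 2 + η + τ) / (ε ^ 7 * H / L) + (κ + η) / τ) ≤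
      60 * H / L * ((Real.log 2 + η + τ) / (ε ^ 7 * H / L) + (κ + η) / τ) := by
    refine mul_le_mul_of_nonneg_right ?_ hQ0
    have h1 : 8 * H * σ + 4 * #Pr ≤ 8 * H * (6 / L) + 4 * (3 * (ε ^ 2 * H) / L) :=
      add_le_add (mul_le_mul_of_nonneg_left hσ6 (by positivity))
        (mul_le_mul_of_nonneg_left hcard (by norm_num))
    refine h1.trans ?_
    rw [show 8 * H * (6 / L) + 4 * (3 * (ε ^ 2 * H) / L) = (48 + 12 * ε ^ 2) * H / L by ring]
    refine div_le_div_of_nonneg_right ?_ hL0.le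
    have h9 : 48 + 12 * ε ^ 2 ≤ 60 := by linarith only [pow_le_one₀ hε.le hε1 (n := 2)]
    exact mul_le_mul_of_nonneg_right h9 hH0.le
  -- assemble
  have key : H * σ * X₀ - a ^ 2 * σ - 2 * h.natAbs * #Pr -
      ((a : ℝ) ^ 2 + 2 * a * H + 2 * h.natAbs * H) * #Pr * ((4 * H + 2 * L + 12) / S) -
      3 * ε ^ 2 * (H * σ + #Pr) - (ε ^ 2 * H / L + (8 * H * σ + 4 * #Pr) *
        ((Real.log 2 + η + τ) / (ε ^ 7 * H / L) + (κ + η) / τ)) - 3 * ε ^ 2 * (H * σ) ≤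
      ‖logAvg G x ω‖ := by linarith only [h26, htri, hdisc, hdec, hund]
  linarith only [key, hmainX, he1, he2, he3, he4, he5, he6, h46]

/-- `𝔼 Z = ∑_n w_n Z(n)` with the normalised weights `w_n = (1/n)/S`. [folklore] -/
theorem logAvg_eq_sum_smul (Z : ℕ → ℂ) (x ω : ℝ) :
    logAvg Z x ω = ∑ n ∈ Ioc ⌊x / ω⌋₊ ⌊x⌋₊, (((n : ℝ)⁻¹ / logWeightSum x ω : ℝ) : ℂ) * Z n := by
  unfold logAvg wsum
  rw [sum_div]
  refine sum_congr rfl fun n _ => ?_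
  push_cast
  ring

/-- **The concluding step at a good scale** (Tao 2016, §3, from the undiscretised decoupled bound to
"`ε ≪_{a,h} ε² + o_{H₋→∞}(|Ξ_H|)`"): if
`κ' H/log H ≤ |𝔼 ∑_{p∈𝒫_H} (c_p/p) ∑_{j ≡ pb (a)} g₁(a𝐧+j) g₂(a𝐧+j+ph)|` and (2.10) holds at
`H` with bound `B` (all frequencies), then by Lemma 3.6 (`Literature.NumberTheory.LFunctions.Tao2016.endgame`) and (2.12)
(`Literature.NumberTheory.LFunctions.Tao2016.wsum_div_logWeightSum_shortExpSum_mul_le`),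
`κ' ≤ (6 + 3|h|)(ε² + #Ξ_H · a (B + 8 + 2 log a)/S)`.
[cite: TaoFMP2016, §3 (the paragraph after Lemma 3.6) and §2 (2.12)] -/
theorem endgame_bound {g₁ g₂ : ℕ → ℂ} (hb₁ : ∀ n, ‖g₁ n‖ ≤ 1) (hb₂ : ∀ n, ‖g₂ n‖ ≤ 1)
    {a H : ℕ} (ha : 1 ≤ a) (haH : a ∣ H) (hH1 : 1 ≤ H) (b h : ℤ) {ε : ℝ} (hε : 0 < ε)
    (hε1 : ε ≤ 1) (hH : 4 ≤ ε ^ 4 * H) {x ω : ℝ} (hS : 0 < logWeightSum x ω) {κ' B : ℝ}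
    (hlow : κ' * (H / Real.log H) ≤
      ‖logAvg (fun n => bilinC H a b h (primesP ε H) (cCoeff g₁ g₂) (seqAt g₁ (a * n))
        (seqAt g₂ (a * n))) x ω‖)
    (h210 : ∀ α : ℝ, logAvgShortExpSum g₁ x ω H α ≤ B) :
    κ' ≤ (6 + 3 * |(h : ℝ)|) * (ε ^ 2 +
      (Xi (primesP ε H) (cCoeff g₁ g₂) a H b h (ε ^ 2 / Real.log H)).card *
        (a * (B + 8 + 2 * Real.log a) / logWeightSum x ω)) := by
  set w : ℕ → ℝ := fun n => (n : ℝ)⁻¹ / logWeightSum x ω with hw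
  have hw0 : ∀ n ∈ Ioc ⌊x / ω⌋₊ ⌊x⌋₊, 0 ≤ w n := fun n _ => by rw [hw]; positivity
  have hw1 : ∑ n ∈ Ioc ⌊x / ω⌋₊ ⌊x⌋₊, w n = 1 := by
    rw [hw]; simp only
    rw [← sum_div, div_eq_one_iff_eq hS.ne']
    rfl
  have hc : ∀ p ∈ primesP ε H, ‖cCoeff g₁ g₂ p‖ ≤ 1 := fun p _ => norm_cCoeff_le hb₁ hb₂ p
  have hx₁ : ∀ n ∈ Ioc ⌊x / ω⌋₊ ⌊x⌋₊, ∀ j ∈ Icc (1 : ℤ) H, ‖seqAt g₁ (a * n) j‖ ≤ 1 :=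
    fun n _ j _ => hb₁ _
  have hx₂ : ∀ n ∈ Ioc ⌊x / ω⌋₊ ⌊x⌋₊, ∀ j ∈ Icc (1 : ℤ) H, ‖seqAt g₂ (a * n) j‖ ≤ 1 :=
    fun n _ j _ => hb₂ _
  have hlow' : κ' * (H / Real.log H) ≤ ‖∑ n ∈ Ioc ⌊x / ω⌋₊ ⌊x⌋₊, (w n : ℂ) *
      bilinC H a b h (primesP ε H) (cCoeff g₁ g₂) (seqAt g₁ (a * n)) (seqAt g₂ (a * n))‖ := by
    rw [← logAvg_eq_sum_smul]; exact hlow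
  have hg : ∀ n : ℕ, 1 ≤ n → ‖g₁ n‖ ≤ 1 := fun n _ => hb₁ n
  have hup : ∀ ξ ∈ Xi (primesP ε H) (cCoeff g₁ g₂) a H b h (ε ^ 2 / Real.log H),
      ∑ n ∈ Ioc ⌊x / ω⌋₊ ⌊x⌋₊, w n * ‖dft H (seqAt g₁ (a * n)) ξ‖ ≤
        a * (B + 8 + 2 * Real.log a) / logWeightSum x ω := by
    intro ξ _
    have h1 := wsum_div_logWeightSum_shortExpSum_mul_le hg ha hH1 hS (-(ξ : ℝ) / H) (h210 _)
      (a := a) (x := x) (ω := ω)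
    refine le_trans (le_of_eq ?_) h1
    rw [hw, sum_div]
    refine sum_congr rfl fun n _ => ?_
    simp only
    rw [norm_dft_seqAt]
    push_cast
    field_simp
  exact endgame (Ioc ⌊x / ω⌋₊ ⌊x⌋₊) w hw0 hw1 ha haH b h hε hε1 hH (cCoeff g₁ g₂) hc
    (fun n => seqAt g₁ (a * n)) (fun n => seqAt g₂ (a * n)) hx₁ hx₂ hlow' hup

/-! ## Part 3. The theorem -/

/-- `(h.natAbs : ℝ) = |h|`. [folklore] -/
theorem natAbs_cast_eq_abs (h : ℤ) : ((h.natAbs : ℕ) : ℝ) = |(h : ℝ)| := by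
  rw [← Int.cast_natCast, Int.natCast_natAbs, Int.cast_abs]

set_option maxHeartbeats 800000 in
/-- **Tao 2016, proof of Theorem 2.3 at a good scale: the undiscretised decoupled lower bound**
(the second display following the proof of Lemma 3.5).
In the notation of the paper: `g₁, g₂` completely multiplicative and unimodular (and
`1`-bounded), `a ≥ 1`, `b`, `h`; `ε₁ ≤ min(1/27648, ε/(256 a (6|h| + 286)))`; a scale
`H ∈ [16, H₊]`, `a ≤ H`, large in terms of `ε₁` (`ε₁⁴H ≥ 4`, `ε₁⁷H ≥ 2 log H`,
`ε₁¹⁰ H ≥ 2 log H`, `ε₁¹³ H ≥ log H`, `ε₁²H > 2a`, `ε H ≥ 384 a³`), with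
`∑_{p∈𝒫_H} 1/p ≥ 1/(4 log H)` (PNT); a range with `S = ∑_{x/ω<n≤x} 1/n > 0`, `x/ω ≥ |h| + 1`
and `S` large in terms of `H₊` (`hS3`); the entropy data `𝐇(Y_H) ≥ log P_H - η` with
`0 ≤ η ≤ 1` and `𝐈(X_H : Y_H) ≤ ε₁¹³ H / log H` (Lemma 3.2); and
`|𝔼 1_{𝐧 ≡ b (a)} g₁(𝐧) g₂(𝐧+h)| ≥ ε/(4a)` ((2.8) via (2.14)).  Then
`|𝔼 ∑_{p∈𝒫_H} (c_p/p) ∑_{j ≡ pb (a)} g₁(a𝐧+j) g₂(a𝐧+j+ph)| ≥ (ε/(64a)) H/log H`.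
[cite: TaoFMP2016, §3 (proof of Theorem 2.3: from (2.15) to the second display following the proof of Lemma 3.5)] -/
theorem scale_low {g₁ g₂ : ℕ → ℂ}
    (hcm₁ : ∀ m n : ℕ, 1 ≤ m → 1 ≤ n → g₁ (m * n) = g₁ m * g₁ n)
    (hcm₂ : ∀ m n : ℕ, 1 ≤ m → 1 ≤ n → g₂ (m * n) = g₂ m * g₂ n)
    (hS₁ : ∀ n : ℕ, 1 ≤ n → ‖g₁ n‖ = 1) (hS₂ : ∀ n : ℕ, 1 ≤ n → ‖g₂ n‖ = 1)
    (hb₁ : ∀ n, ‖g₁ n‖ ≤ 1) (hb₂ : ∀ n, ‖g₂ n‖ ≤ 1)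
    {a : ℕ} (ha : 1 ≤ a) (b h : ℤ) {ε : ℝ} (hε : 0 < ε)
    {ε₁ : ℝ} (hε₁ : 0 < ε₁) (hε₁0 : ε₁ ≤ 1 / 27648)
    (hε₁ε : ε₁ ≤ ε / (256 * a * (6 * (h.natAbs : ℝ) + 286)))
    {H Hp : ℕ} (hHHp : H ≤ Hp) (h16 : 16 ≤ H) (haH : a ≤ H)
    (hH4 : 4 ≤ ε₁ ^ 4 * H) (hH7 : 2 ≤ ε₁ ^ 7 * H / Real.log H)
    (hH10 : 2 * Real.log H ≤ ε₁ ^ 10 * H) (hH13 : Real.log H ≤ ε₁ ^ 13 * H)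
    (haε : (a : ℝ) < ε₁ ^ 2 * H / 2) (hHε : 384 * (a : ℝ) ^ 3 ≤ ε * H)
    (hσ : 1 / (4 * Real.log H) ≤ ∑ p ∈ primesP ε₁ H, 1 / (p : ℝ))
    {x ω : ℝ} (hS : 0 < logWeightSum x ω) (hrange : (h.natAbs : ℝ) + 1 ≤ x / ω)
    (hS3 : 3456 * a * ((a : ℝ) ^ 2 + 2 * a + 2 * h.natAbs) * (Hp : ℝ) ^ 2 ≤ ε * logWeightSum x ω)
    {η : ℝ} (hη0 : 0 ≤ η) (hη1 : η ≤ 1)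
    (hent : Real.log ((∏ p ∈ primesP ε₁ H, p : ℕ) : ℝ) - η ≤
      ent (logSpace x ω) logWeight (fun n => n % ∏ p ∈ primesP ε₁ H, p))
    (hI : mutualInfo (logSpace x ω) logWeight (window (process (pairRound (ε₁ ^ 2) g₁ g₂) a) 0 H)
      (fun n => n % ∏ p ∈ primesP ε₁ H, p) ≤ ε₁ ^ 13 * H / Real.log H)
    (hX : ε / (4 * a) ≤ ‖logAvg (corrInd a b h g₁ g₂) x ω‖) :
    ε / (64 * a) * (H / Real.log H) ≤
      ‖logAvg (fun n => bilinC H a b h (primesP ε₁ H) (cCoeff g₁ g₂) (seqAt g₁ (a * n))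
        (seqAt g₂ (a * n))) x ω‖ := by
  -- basic sizes
  have haR : (1 : ℝ) ≤ a := by exact_mod_cast ha
  have ha0 : (0 : ℝ) < a := by linarith
  have hε₁1 : ε₁ ≤ 1 := hε₁0.trans (by norm_num)
  have hHR : (16 : ℝ) ≤ H := by exact_mod_cast h16
  have hH0 : (0 : ℝ) < H := by linarith
  have hH1 : 1 ≤ H := le_trans (by norm_num) h16
  have hHpR : (H : ℝ) ≤ Hp := by exact_mod_cast hHHp
  have hL1 : 1 ≤ Real.log H := by
    rw [← Real.log_exp 1]
    refine Real.log_le_log (Real.exp_pos 1) ?_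
    have := Real.exp_one_lt_d9
    linarith
  have hL0 : 0 < Real.log H := by linarith
  have hLH : Real.log H ≤ H := (Real.log_le_sub_one_of_pos hH0).trans (by linarith)
  have hHL0 : 0 ≤ (H : ℝ) / Real.log H := by positivity
  have hhabs : (0 : ℝ) ≤ h.natAbs := Nat.cast_nonneg _
  -- Step A: the lower bound at the scale
  have hτ : 0 < ε₁ ^ 10 * H / Real.log H := by positivity
  have hκ : 0 ≤ ε₁ ^ 13 * H / Real.log H := by positivity
  have hX0 : 0 ≤ ε / (4 * a) := by positivity
  have hA := scale_lower_bound hcm₁ hcm₂ hS₁ hS₂ hb₁ hb₂ ha b h hε₁ hε₁0 h16 haH hH4 hH7 haε hσ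
    hS hrange hκ hη0 hτ hent hI hX0 hX
  -- the decoupling ratio
  have hR := Numeric.ratio_bound (η := η) hε₁ hH0 hL0 hη1 hH10 hH13
  have hR2 : (Real.log 2 + η + ε₁ ^ 10 * H / Real.log H) / (ε₁ ^ 7 * H / Real.log H) +
      (ε₁ ^ 13 * H / Real.log H + η) / (ε₁ ^ 10 * H / Real.log H) ≤ 4 * ε₁ ^ 2 := by
    refine hR.trans ?_
    have : ε₁ ^ 3 ≤ ε₁ ^ 2 := by
      calc ε₁ ^ 3 = ε₁ ^ 2 * ε₁ := by ring
        _ ≤ ε₁ ^ 2 * 1 := by gcongr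
        _ = ε₁ ^ 2 := mul_one _
    linarith
  -- (i) `6a²/log H`
  have hi : 6 * (a : ℝ) ^ 2 / Real.log H ≤ ε / (64 * a) * (H / Real.log H) := by
    rw [show ε / (64 * a) * (H / Real.log H) = (ε * H / (64 * a)) / Real.log H by
      field_simp]
    refine div_le_div_of_nonneg_right ?_ hL0.le
    rw [le_div_iff₀ (by positivity)]
    linarith only [hHε]
  -- (ii) the `ε₁²` terms
  have hε₁sq : ε₁ ^ 2 ≤ ε₁ := pow_le_of_le_one hε₁.le hε₁1 two_ne_zero
  have hii0 : (6 * (h.natAbs : ℝ) + 286) * ε₁ ^ 2 ≤ ε / (64 * a) := by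
    have h1 : (6 * (h.natAbs : ℝ) + 286) * ε₁ ≤ ε / (256 * a) := by
      have := mul_le_mul_of_nonneg_left hε₁ε (by positivity : (0 : ℝ) ≤ 6 * h.natAbs + 286)
      refine this.trans (le_of_eq ?_)
      field_simp
    have h2 : ε / (256 * a) ≤ ε / (64 * a) := by
      rw [div_le_div_iff₀ (by positivity) (by positivity)]
      have := mul_pos hε ha0
      linarith
    have h3 := mul_le_mul_of_nonneg_left hε₁sq (by positivity : (0 : ℝ) ≤ 6 * h.natAbs + 286)
    linarith only [h1, h2, h3]
  have hii : 6 * (h.natAbs : ℝ) * ε₁ ^ 2 * H / Real.log H + 46 * ε₁ ^ 2 * H / Real.log H +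
      60 * H / Real.log H * ((Real.log 2 + η + ε₁ ^ 10 * H / Real.log H) /
        (ε₁ ^ 7 * H / Real.log H) + (ε₁ ^ 13 * H / Real.log H + η) / (ε₁ ^ 10 * H / Real.log H)) ≤
      ε / (64 * a) * (H / Real.log H) := by
    have e1 : 6 * (h.natAbs : ℝ) * ε₁ ^ 2 * H / Real.log H =
        6 * (h.natAbs : ℝ) * ε₁ ^ 2 * (H / Real.log H) := by ring
    have e2 : 46 * ε₁ ^ 2 * H / Real.log H = 46 * ε₁ ^ 2 * (H / Real.log H) := by ring
    have e3 : 60 * H / Real.log H * ((Real.log 2 + η + ε₁ ^ 10 * H / Real.log H) /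
        (ε₁ ^ 7 * H / Real.log H) + (ε₁ ^ 13 * H / Real.log H + η) / (ε₁ ^ 10 * H / Real.log H)) ≤
        60 * (H / Real.log H) * (4 * ε₁ ^ 2) := by
      rw [show 60 * (H : ℝ) / Real.log H = 60 * (H / Real.log H) by ring]
      exact mul_le_mul_of_nonneg_left hR2 (by positivity)
    have e5 := mul_le_mul_of_nonneg_right hii0 hHL0
    linarith only [e1, e2, e3, e5]
  -- (iii) the `1/S` term
  have hiii : ((a : ℝ) ^ 2 + 2 * a * H + 2 * h.natAbs * H) * (3 * (ε₁ ^ 2 * H) / Real.log H) *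
      ((4 * H + 2 * Real.log H + 12) / logWeightSum x ω) ≤ ε / (64 * a) * (H / Real.log H) := by
    have hT : (a : ℝ) ^ 2 + 2 * a * H + 2 * h.natAbs * H ≤ ((a : ℝ) ^ 2 + 2 * a + 2 * h.natAbs) * H := by
      have : (a : ℝ) ^ 2 ≤ a ^ 2 * H := le_mul_of_one_le_right (sq_nonneg _) (by linarith)
      linarith only [this]
    have hT0 : 0 ≤ (a : ℝ) ^ 2 + 2 * a * H + 2 * h.natAbs * H := by positivity
    have h3 : 3 * (ε₁ ^ 2 * H) / Real.log H ≤ 3 * (H / Real.log H) := by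
      rw [show 3 * ((H : ℝ) / Real.log H) = 3 * H / Real.log H by ring]
      refine div_le_div_of_nonneg_right ?_ hL0.le
      have h' : ε₁ ^ 2 * H ≤ 1 * H := mul_le_mul_of_nonneg_right (pow_le_one₀ hε₁.le hε₁1) hH0.le
      linarith only [h']
    have h30 : 0 ≤ 3 * (ε₁ ^ 2 * H) / Real.log H := by positivity
    have hQ : (4 * H + 2 * Real.log H + 12) / logWeightSum x ω ≤ 18 * H / logWeightSum x ω := by
      refine div_le_div_of_nonneg_right ?_ hS.le
      linarith only [hLH, hHR]
    have hQ0 : 0 ≤ (4 * H + 2 * Real.log H + 12) / logWeightSum x ω := by positivity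
    have hprod : ((a : ℝ) ^ 2 + 2 * a * H + 2 * h.natAbs * H) * (3 * (ε₁ ^ 2 * H) / Real.log H) *
        ((4 * H + 2 * Real.log H + 12) / logWeightSum x ω) ≤
        (((a : ℝ) ^ 2 + 2 * a + 2 * h.natAbs) * H) * (3 * (H / Real.log H)) *
          (18 * H / logWeightSum x ω) :=
      mul_le_mul (mul_le_mul hT h3 h30 (by positivity)) hQ hQ0 (by positivity)
    refine hprod.trans ?_
    rw [show (((a : ℝ) ^ 2 + 2 * a + 2 * h.natAbs) * H) * (3 * (H / Real.log H)) *
        (18 * H / logWeightSum x ω) =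
        (54 * ((a : ℝ) ^ 2 + 2 * a + 2 * h.natAbs) * H ^ 2 / logWeightSum x ω) * (H / Real.log H) by
      field_simp; ring]
    refine mul_le_mul_of_nonneg_right ?_ hHL0
    rw [div_le_div_iff₀ hS (by positivity)]
    have hH2 : (H : ℝ) ^ 2 ≤ (Hp : ℝ) ^ 2 := by gcongr
    have h0 : 0 ≤ (a : ℝ) ^ 2 + 2 * a + 2 * h.natAbs := by positivity
    calc 54 * ((a : ℝ) ^ 2 + 2 * a + 2 * h.natAbs) * H ^ 2 * (64 * a)
        = 3456 * a * ((a : ℝ) ^ 2 + 2 * a + 2 * h.natAbs) * H ^ 2 := by ring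
      _ ≤ 3456 * a * ((a : ℝ) ^ 2 + 2 * a + 2 * h.natAbs) * Hp ^ 2 := by gcongr
      _ ≤ ε * logWeightSum x ω := hS3
  -- the main term
  have hm : (H : ℝ) * (ε / (4 * a)) / (4 * Real.log H) = 4 * (ε / (64 * a)) * (H / Real.log H) := by
    field_simp
    ring
  linarith only [hA, hi, hii, hiii, hm]

set_option maxHeartbeats 400000 in
/-- **Tao 2016, proof of Theorem 2.3: the contradiction at a good scale.**  With the data of
`scale_low`, and moreover `a ∣ H`, `|Ξ_H| ≤ C_Ξ a ε₁⁻¹⁰ (log log H)⁸` (Lemma 3.7),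
`(log log H)⁹` small against `log H` (`hll`), `log ω ≤ S + 1`, `S` large in terms of `H₊`
(`hS4`) and (2.10) at `H` with constant `C ≥ 0`: `False` (Lemma 3.6, (2.12) and the concluding
paragraph of §3). [cite: TaoFMP2016, §3 (concluding paragraph of the proof of Theorem 2.3)] -/
theorem scale_contradiction {g₁ g₂ : ℕ → ℂ}
    (hcm₁ : ∀ m n : ℕ, 1 ≤ m → 1 ≤ n → g₁ (m * n) = g₁ m * g₁ n)
    (hcm₂ : ∀ m n : ℕ, 1 ≤ m → 1 ≤ n → g₂ (m * n) = g₂ m * g₂ n)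
    (hS₁ : ∀ n : ℕ, 1 ≤ n → ‖g₁ n‖ = 1) (hS₂ : ∀ n : ℕ, 1 ≤ n → ‖g₂ n‖ = 1)
    (hb₁ : ∀ n, ‖g₁ n‖ ≤ 1) (hb₂ : ∀ n, ‖g₂ n‖ ≤ 1)
    {a : ℕ} (ha : 1 ≤ a) (b h : ℤ) {ε : ℝ} (hε : 0 < ε)
    {ε₁ : ℝ} (hε₁ : 0 < ε₁) (hε₁0 : ε₁ ≤ 1 / 27648)
    (hε₁ε : ε₁ ≤ ε / (256 * a * (6 * (h.natAbs : ℝ) + 286)))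
    {CΞ : ℝ} (hCΞ : 0 < CΞ) {C : ℝ} (hC : 0 ≤ C)
    {H Hp : ℕ} (hHHp : H ≤ Hp) (h16 : 16 ≤ H) (haH : a ≤ H) (hadvd : a ∣ H)
    (hH4 : 4 ≤ ε₁ ^ 4 * H) (hH7 : 2 ≤ ε₁ ^ 7 * H / Real.log H)
    (hH10 : 2 * Real.log H ≤ ε₁ ^ 10 * H) (hH13 : Real.log H ≤ ε₁ ^ 13 * H)
    (haε : (a : ℝ) < ε₁ ^ 2 * H / 2) (hHε : 384 * (a : ℝ) ^ 3 ≤ ε * H)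
    (hσ : 1 / (4 * Real.log H) ≤ ∑ p ∈ primesP ε₁ H, 1 / (p : ℝ))
    (hXi : ((Xi (primesP ε₁ H) (cCoeff g₁ g₂) a H b h (ε₁ ^ 2 / Real.log H)).card : ℝ) ≤
      CΞ * a * ε₁⁻¹ ^ 10 * Real.log (Real.log H) ^ 8)
    (hll : (6 + 3 * (h.natAbs : ℝ)) * CΞ * a ^ 2 * ε₁⁻¹ ^ 10 * (2 * C) *
      Real.log (Real.log H) ^ 9 ≤ ε / (512 * a) * Real.log H)
    {x ω : ℝ} (hS : 0 < logWeightSum x ω) (hS2 : 2 ≤ logWeightSum x ω)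
    (hωS : Real.log ω ≤ logWeightSum x ω + 1) (hω0 : 0 ≤ Real.log ω)
    (hrange : (h.natAbs : ℝ) + 1 ≤ x / ω)
    (hS3 : 3456 * a * ((a : ℝ) ^ 2 + 2 * a + 2 * h.natAbs) * (Hp : ℝ) ^ 2 ≤ ε * logWeightSum x ω)
    (hS4 : 512 * (a : ℝ) ^ 3 * (6 + 3 * (h.natAbs : ℝ)) * CΞ * ε₁⁻¹ ^ 10 * (Hp : ℝ) ^ 8 *
      (8 + 2 * Real.log a) ≤ ε * logWeightSum x ω)
    {η : ℝ} (hη0 : 0 ≤ η) (hη1 : η ≤ 1)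
    (hent : Real.log ((∏ p ∈ primesP ε₁ H, p : ℕ) : ℝ) - η ≤
      ent (logSpace x ω) logWeight (fun n => n % ∏ p ∈ primesP ε₁ H, p))
    (hI : mutualInfo (logSpace x ω) logWeight (window (process (pairRound (ε₁ ^ 2) g₁ g₂) a) 0 H)
      (fun n => n % ∏ p ∈ primesP ε₁ H, p) ≤ ε₁ ^ 13 * H / Real.log H)
    (hX : ε / (4 * a) ≤ ‖logAvg (corrInd a b h g₁ g₂) x ω‖)
    (h210 : ∀ α : ℝ, logAvgShortExpSum g₁ x ω H α ≤
      C * (Real.log (Real.log H) / Real.log H) * Real.log ω) : False := by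
  have haR : (1 : ℝ) ≤ a := by exact_mod_cast ha
  have hε₁1 : ε₁ ≤ 1 := hε₁0.trans (by norm_num)
  have hHR : (16 : ℝ) ≤ H := by exact_mod_cast h16
  have hH0 : (0 : ℝ) < H := by linarith
  have hH1 : 1 ≤ H := le_trans (by norm_num) h16
  have hHpR : (H : ℝ) ≤ Hp := by exact_mod_cast hHHp
  have hL1 : 1 ≤ Real.log H := by
    rw [← Real.log_exp 1]
    refine Real.log_le_log (Real.exp_pos 1) ?_
    have := Real.exp_one_lt_d9
    linarith
  have hL0 : 0 < Real.log H := by linarith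
  have hLH : Real.log H ≤ H := (Real.log_le_sub_one_of_pos hH0).trans (by linarith)
  have hlow := scale_low hcm₁ hcm₂ hS₁ hS₂ hb₁ hb₂ ha b h hε hε₁ hε₁0 hε₁ε hHHp h16 haH hH4 hH7
    hH10 hH13 haε hHε hσ hS hrange hS3 hη0 hη1 hent hI hX
  -- Step B: the endgame
  have hB := endgame_bound hb₁ hb₂ ha hadvd hH1 b h hε₁ hε₁1 hH4 hS hlow h210
  -- Step C: numerics
  have habs : ((h.natAbs : ℕ) : ℝ) = |(h : ℝ)| := natAbs_cast_eq_abs h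
  rw [habs] at hε₁ε hll hS4
  have hlogL0 : 0 ≤ Real.log (Real.log H) := Real.log_nonneg hL1
  have hlogL : Real.log (Real.log H) ^ 8 ≤ (Hp : ℝ) ^ 8 := by
    have h1 : Real.log (Real.log H) ≤ Real.log H :=
      (Real.log_le_sub_one_of_pos hL0).trans (by linarith)
    exact pow_le_pow_left₀ hlogL0 (h1.trans (hLH.trans hHpR)) 8
  have hB0 : 0 ≤ C * (Real.log (Real.log H) / Real.log H) * Real.log ω := by positivity
  exact Numeric.endgame_numeric hε haR (abs_nonneg _) hε₁ hε₁1 hε₁ε hCΞ hC (by linarith) hL0 hlogL0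
    hlogL hXi le_rfl hB0 hωS hll hS4 hB

/-! ### From (2.8) to `|𝔼 1_{𝐧 ≡ b (a)} g₁(𝐧) g₂(𝐧+h)| ≫ ε` ((2.14)) -/

/-- **Tao 2016, (2.8) ⇒ (2.14)** (Lemma 2.5 and the dilation invariance of complete
multiplicativity are not even needed in this direction: only Lemma 2.5(i) in the `modEq` form
`Literature.NumberTheory.LFunctions.Tao2016.norm_logAvg_filter_modEq_sub_le`): for `1`-bounded `g₁, g₂`, if `an + b ≥ 0` on
the range and `|⌊b/a⌋| ≤ x/ω`, then
`|∑_{x/ω<n≤x} g₁(an+b) g₂(an+b+h)/n| / (a S) - (8 + 2 log a + 4|⌊b/a⌋|)/S ≤ |𝔼 1_{𝐧 ≡ b (a)} g₁(𝐧) g₂(𝐧+h)|`,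
`S = ∑_{x/ω<n≤x} 1/n`. [cite: TaoFMP2016, §2 ((2.13), (2.14))] -/
theorem corrInd_lower_bound {g₁ g₂ : ℕ → ℂ} (hb₁ : ∀ n, ‖g₁ n‖ ≤ 1) (hb₂ : ∀ n, ‖g₂ n‖ ≤ 1)
    {a : ℕ} (ha : 1 ≤ a) (b h : ℤ) {x ω : ℝ} (hS : 0 < logWeightSum x ω)
    (hk : (((b / a : ℤ).natAbs : ℕ) : ℝ) ≤ x / ω)
    (hbpos : ∀ n ∈ Ioc ⌊x / ω⌋₊ ⌊x⌋₊, 0 ≤ (a : ℤ) * n + b) :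
    ‖∑ n ∈ Ioc ⌊x / ω⌋₊ ⌊x⌋₊,
        g₁ ((a : ℤ) * n + b).toNat * g₂ ((a : ℤ) * n + b + h).toNat / (n : ℂ)‖ /
          (a * logWeightSum x ω) -
        (8 + 2 * Real.log a + 4 * ((b / a : ℤ).natAbs : ℕ)) / logWeightSum x ω ≤
      ‖logAvg (corrInd a b h g₁ g₂) x ω‖ := by
  set Z : ℕ → ℂ := fun n => g₁ n * g₂ ((n : ℤ) + h).toNat with hZ
  have hZb : ∀ n, ‖Z n‖ ≤ 1 := fun n => by
    rw [hZ]; simp only; rw [norm_mul]; exact mul_le_one₀ (hb₁ _) (norm_nonneg _) (hb₂ _)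
  have ha0 : 0 < a := ha
  have haR : (0 : ℝ) < a := by exact_mod_cast ha0
  have h25 := norm_logAvg_filter_modEq_sub_le hZb ha0 b hS hk (x := x) (ω := ω)
  have e1 : (fun n : ℕ => if (n : ℤ) ≡ b [ZMOD a] then Z n else 0) = corrInd a b h g₁ g₂ := rfl
  have e2 : logAvg (fun n => Z (((a : ℤ) * n + b).toNat)) x ω =
      (∑ n ∈ Ioc ⌊x / ω⌋₊ ⌊x⌋₊,
        g₁ ((a : ℤ) * n + b).toNat * g₂ ((a : ℤ) * n + b + h).toNat / (n : ℂ)) /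
        (logWeightSum x ω : ℂ) := by
    unfold logAvg wsum
    congr 1
    refine sum_congr rfl fun n hn => ?_
    rw [hZ]
    simp only
    rw [Int.toNat_of_nonneg (hbpos n hn)]
  rw [e1, e2] at h25
  set T := ∑ n ∈ Ioc ⌊x / ω⌋₊ ⌊x⌋₊,
    g₁ ((a : ℤ) * n + b).toNat * g₂ ((a : ℤ) * n + b + h).toNat / (n : ℂ) with hT
  have hnorm : ‖(1 / (a : ℂ)) * (T / (logWeightSum x ω : ℂ))‖ = ‖T‖ / (a * logWeightSum x ω) := by
    rw [norm_mul, norm_div, norm_div, norm_one, Complex.norm_natCast, Complex.norm_real,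
      Real.norm_of_nonneg hS.le]
    field_simp
  have hrev := norm_sub_norm_le ((1 / (a : ℂ)) * (T / (logWeightSum x ω : ℂ)))
    (logAvg (corrInd a b h g₁ g₂) x ω)
  rw [← norm_sub_rev] at h25
  rw [hnorm] at hrev
  linarith

/-! ### Normalising `gᵢ(0) = 0` -/

/-- Setting `g(0) = 0` preserves complete multiplicativity on `ℕ₊`. [folklore] -/
theorem update_zero_mul {g : ℕ → ℂ} (hcm : ∀ m n : ℕ, 1 ≤ m → 1 ≤ n → g (m * n) = g m * g n) :
    ∀ m n : ℕ, 1 ≤ m → 1 ≤ n →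
      Function.update g 0 0 (m * n) = Function.update g 0 0 m * Function.update g 0 0 n := by
  intro m n hm hn
  rw [Function.update_of_ne (Nat.mul_pos hm hn).ne', Function.update_of_ne (by omega : m ≠ 0),
    Function.update_of_ne (by omega : n ≠ 0)]
  exact hcm m n hm hn

/-- Setting `g(0) = 0` preserves unimodularity on `ℕ₊`. [folklore] -/
theorem update_zero_unimod {g : ℕ → ℂ} (hS : ∀ n : ℕ, 1 ≤ n → ‖g n‖ = 1) :
    ∀ n : ℕ, 1 ≤ n → ‖Function.update g 0 0 n‖ = 1 := by
  intro n hn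
  rw [Function.update_of_ne (by omega : n ≠ 0)]
  exact hS n hn

/-- After setting `g(0) = 0`, `|g| ≤ 1` everywhere. [folklore] -/
theorem update_zero_bound {g : ℕ → ℂ} (hS : ∀ n : ℕ, 1 ≤ n → ‖g n‖ = 1) :
    ∀ n : ℕ, ‖Function.update g 0 0 n‖ ≤ 1 := by
  intro n
  rcases Nat.eq_zero_or_pos n with rfl | hn
  · simp
  · rw [update_zero_unimod hS n hn]

/-- The short exponential sums (2.10) do not see `g(0)`. [folklore] -/
theorem logAvgShortExpSum_update_zero (g : ℕ → ℂ) (x ω : ℝ) (H : ℕ) (α : ℝ) :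
    logAvgShortExpSum (Function.update g 0 0) x ω H α = logAvgShortExpSum g x ω H α := by
  unfold logAvgShortExpSum shortExpSum
  refine sum_congr rfl fun n _ => ?_
  congr 2
  refine sum_congr rfl fun j hj => ?_
  have := (mem_Icc.1 hj).1
  rw [Function.update_of_ne (by omega : n + j ≠ 0)]

/-! ### The theorem -/

set_option maxHeartbeats 1600000 in
/-- **Tao 2016, Theorem 2.3 from (2.10)** — the named fact `Literature.NumberTheory.LFunctions.Tao2016_theorem23_core` holds:
in the hierarchy `H₋ = H₋(a, b, h, ε, C, H₀)`, `H₊ = H₊(H₋)`, `A₀ = A₀(H₊)`, for `A ≥ A₀`,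
`x ≥ x/log x ≥ ω ≥ A`, completely multiplicative unimodular `g₁, g₂` with (2.10) on `[H₋, H₊]`,
`|∑_{x/ω<n≤x} g₁(an+b) g₂(an+b+h)/n| ≤ ε log ω`.
[cite: TaoFMP2016, §2 (after Proposition 2.4), §3 and §4] -/
theorem Tao2016_theorem23_core_holds : Tao2016_theorem23_core := by
  intro a b h ha hh ε C H₀ hε
  -- constants depending on `a, b, h, ε, C`
  obtain ⟨CΞ, hCΞ, hXiC⟩ := card_Xi_primesP_le
  have ha0 : 0 < a := ha
  have haR : (1 : ℝ) ≤ a := by exact_mod_cast ha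
  have haR0 : (0 : ℝ) < a := by linarith only [haR]
  have hhabs : (0 : ℝ) ≤ h.natAbs := Nat.cast_nonneg _
  set ε' : ℝ := min ε 1 with hε'
  have hε'0 : 0 < ε' := lt_min hε one_pos
  have hε'1 : ε' ≤ 1 := min_le_right _ _
  have hε'ε : ε' ≤ ε := min_le_left _ _
  set ε₁ : ℝ := min (1 / 27648) (ε' / (256 * a * (6 * h.natAbs + 286))) with hε₁def
  have hε₁ : 0 < ε₁ := lt_min (by norm_num) (by positivity)
  have hε₁0 : ε₁ ≤ 1 / 27648 := min_le_left _ _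
  have hε₁1 : ε₁ ≤ 1 := hε₁0.trans (by norm_num)
  have hε₁ε : ε₁ ≤ ε' / (256 * a * (6 * h.natAbs + 286)) := min_le_right _ _
  have habs : ((h.natAbs : ℕ) : ℝ) = |(h : ℝ)| := natAbs_cast_eq_abs h
  have h2h : 2 * |(h : ℝ)| * ε₁ ^ 2 < 1 := by
    rw [← habs]
    have h1 : ε₁ ^ 2 ≤ ε₁ := pow_le_of_le_one hε₁.le hε₁1 two_ne_zero
    have h2 : ε' / (256 * a * (6 * h.natAbs + 286)) ≤ 1 / (6 * h.natAbs + 286) := by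
      rw [div_le_div_iff₀ (by positivity) (by positivity)]
      have h5 : (6 * (h.natAbs : ℝ) + 286) * 1 ≤ (6 * h.natAbs + 286) * (256 * a) := by
        refine mul_le_mul_of_nonneg_left ?_ (by positivity); linarith only [haR]
      have h6 : ε' * (6 * (h.natAbs : ℝ) + 286) ≤ 1 * (6 * h.natAbs + 286) :=
        mul_le_mul_of_nonneg_right hε'1 (by positivity)
      linarith only [h5, h6]
    have h3 : 2 * (h.natAbs : ℝ) * (1 / (6 * h.natAbs + 286)) < 1 := by
      rw [← mul_div_assoc, mul_one, div_lt_one (by positivity)]; linarith only [hhabs]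
    have h4 : 2 * (h.natAbs : ℝ) * ε₁ ^ 2 ≤ 2 * h.natAbs * (1 / (6 * h.natAbs + 286)) :=
      mul_le_mul_of_nonneg_left (h1.trans (hε₁ε.trans h2)) (by positivity)
    linarith only [h3, h4]
  set Cp : ℝ := max C 0 with hCp
  have hCp0 : 0 ≤ Cp := le_max_right _ _
  have hCCp : C ≤ Cp := le_max_left _ _
  set K : ℝ := (6 + 3 * (h.natAbs : ℝ)) * CΞ * a ^ 2 * ε₁⁻¹ ^ 10 * (2 * Cp) with hK
  have hK0 : 0 ≤ K := by rw [hK]; positivity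
  set c₉ : ℝ := ε' / (512 * a * (K + 1)) with hc₉
  have hc₉0 : 0 < c₉ := by rw [hc₉]; positivity
  -- the thresholds in `H`
  set K₀ : ℝ := 16 * (2 / ε₁ ^ 7) ^ 2 + 16 + (16 * (2 / ε₁ ^ 10) ^ 2 + 16) +
    (16 * (1 / ε₁ ^ 13) ^ 2 + 16) + 4 / ε₁ ^ 4 + (2 * a / ε₁ ^ 2 + 1) + 384 * a ^ 3 / ε' with hK₀
  have hev₁ : ∀ᶠ H : ℕ in atTop, K₀ ≤ (H : ℝ) := tendsto_natCast_atTop_atTop.eventually_ge_atTop K₀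
  have hev₂ := card_primesP_ge hε₁ hε₁1
  have hev₃ := hXiC a b h ha0 hh ε₁ hε₁ hε₁1 h2h
  have hev₄ := Numeric.eventually_log_log_pow_le hc₉0
  obtain ⟨N, hN⟩ := Filter.eventually_atTop.1 (hev₁.and (hev₂.and (hev₃.and hev₄)))
  set Hm : ℕ := max (max H₀ N) (max a 16) with hHm
  have hHmN : N ≤ Hm := le_trans (le_max_right _ _) (le_max_left _ _)
  have hHma : a ≤ Hm := le_trans (le_max_left _ _) (le_max_right _ _)
  have hHm16 : 16 ≤ Hm := le_trans (le_max_right _ _) (le_max_right _ _)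
  -- `H₊`
  have hδ : 0 < ε₁ ^ 2 := by positivity
  have hc₀ : 0 < ε₁ ^ 13 := by positivity
  obtain ⟨Hp₀, hgood⟩ := exists_good_scale a ha Hm hδ hc₀
  set Hp : ℕ := max Hm Hp₀ with hHp
  have hHmHp : Hm ≤ Hp := le_max_left _ _
  refine ⟨Hm, Hp, le_trans (le_max_left _ _) (le_max_left _ _), hHmHp, ?_⟩
  -- `A₀`
  set NV : ℝ := ((#(meshAlphabet (ε₁ ^ 2) ×ˢ meshAlphabet (ε₁ ^ 2)) ^ Hp * 4 ^ Hp : ℕ) : ℝ) with hNV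
  have hNV1 : 1 ≤ NV := by
    rw [hNV]
    have h1 : 1 ≤ #(meshAlphabet (ε₁ ^ 2) ×ˢ meshAlphabet (ε₁ ^ 2)) ^ Hp * 4 ^ Hp :=
      Nat.mul_pos (pow_pos (one_le_card_meshAlphabet_sq hδ) _) (pow_pos (by norm_num) _)
    exact_mod_cast h1
  have hHpR1 : (1 : ℝ) ≤ Hp := by exact_mod_cast le_trans (le_trans (by norm_num) hHm16) hHmHp
  set S₀ : ℝ := (4 * Hp + 2) + 36 * Hp ^ 3 * NV ^ 2 + 9 * 16 ^ Hp * (8 + 4 * Hp) +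
    3456 * a * ((a : ℝ) ^ 2 + 2 * a + 2 * h.natAbs) * Hp ^ 2 / ε' +
    512 * (a : ℝ) ^ 3 * (6 + 3 * (h.natAbs : ℝ)) * CΞ * ε₁⁻¹ ^ 10 * Hp ^ 8 * (8 + 2 * Real.log a) / ε' +
    4 * a * (8 + 2 * Real.log a + 4 * ((b / a : ℤ).natAbs : ℕ)) / ε' +
    (((b / a : ℤ).natAbs : ℕ) + h.natAbs + b.natAbs + 2) with hS₀
  have hloga : 0 ≤ Real.log a := Real.log_nonneg haR
  -- positivity of the summands of `S₀`
  have hs1 : (0 : ℝ) ≤ 4 * Hp + 2 := by positivity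
  have hs2 : (0 : ℝ) ≤ 36 * Hp ^ 3 * NV ^ 2 := by positivity
  have hs3 : (0 : ℝ) ≤ 9 * 16 ^ Hp * (8 + 4 * Hp) := by positivity
  have hs4 : (0 : ℝ) ≤ 3456 * a * ((a : ℝ) ^ 2 + 2 * a + 2 * h.natAbs) * Hp ^ 2 / ε' := by positivity
  have hs5 : (0 : ℝ) ≤ 512 * (a : ℝ) ^ 3 * (6 + 3 * (h.natAbs : ℝ)) * CΞ * ε₁⁻¹ ^ 10 * Hp ^ 8 *
      (8 + 2 * Real.log a) / ε' := by positivity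
  have hs6 : (0 : ℝ) ≤ 4 * a * (8 + 2 * Real.log a + 4 * ((b / a : ℤ).natAbs : ℕ)) / ε' := by positivity
  have hs7 : (0 : ℝ) ≤ ((b / a : ℤ).natAbs : ℕ) + h.natAbs + b.natAbs + 2 := by positivity
  have hS₀2 : 2 ≤ S₀ := by rw [hS₀]; linarith only [hs1, hs2, hs3, hs4, hs5, hs6, hs7]
  refine ⟨Real.exp (S₀ + 1), fun A hA x ω hAω hωx hωx' g₁ g₂ hcm₁ hcm₂ hS₁ hS₂ h210 => ?_⟩
  -- the range
  have hω : Real.exp (S₀ + 1) ≤ ω := hA.trans hAω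
  have hωpos : 0 < ω := lt_of_lt_of_le (Real.exp_pos _) hω
  have hlogω : S₀ + 1 ≤ Real.log ω := by
    rw [← Real.log_exp (S₀ + 1)]; exact Real.log_le_log (Real.exp_pos _) hω
  have hω2 : Real.exp 2 ≤ ω := le_trans (Real.exp_le_exp.2 (by linarith only [hS₀2])) hω
  have hω1 : 1 ≤ ω := le_trans (by have := Real.add_one_le_exp (2 : ℝ); linarith only [this]) hω2
  have hS := logWeightSum_pos hω2 hωx'
  have hSlo := log_sub_one_le_logWeightSum hω1 hωx'
  have hShi := logWeightSum_le hω1 hωx'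
  have hSS₀ : S₀ ≤ logWeightSum x ω := by linarith only [hlogω, hSlo]
  have hlogω0 : 0 ≤ Real.log ω := Real.log_nonneg hω1
  have hxpos : 0 < x := lt_of_lt_of_le hωpos hωx'
  have hlogx : Real.log ω ≤ Real.log x := Real.log_le_log hωpos hωx'
  have hlogx0 : 0 < Real.log x := by linarith only [hlogω, hlogx, hS₀2]
  have hxω : Real.log x ≤ x / ω := by
    rw [le_div_iff₀ hωpos]
    have := (le_div_iff₀ hlogx0).1 hωx
    linarith only [this]
  have hxωS : S₀ + 1 ≤ x / ω := by linarith only [hlogω, hlogx, hxω]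
  -- unpacking `S₀ ≤ S`
  have hS2 : 2 ≤ logWeightSum x ω := by linarith only [hSS₀, hS₀2]
  have hSge1 : 4 * (Hp : ℝ) ≤ logWeightSum x ω := by rw [hS₀] at hSS₀; linarith only [hSS₀, hs1, hs2, hs3, hs4, hs5, hs6, hs7]
  have hSge2 : 36 * (Hp : ℝ) ^ 3 * NV ^ 2 ≤ logWeightSum x ω := by rw [hS₀] at hSS₀; linarith only [hSS₀, hs1, hs2, hs3, hs4, hs5, hs6, hs7]
  have hSge3 : 9 * (16 : ℝ) ^ Hp * (8 + 4 * Hp) ≤ logWeightSum x ω := by rw [hS₀] at hSS₀; linarith only [hSS₀, hs1, hs2, hs3, hs4, hs5, hs6, hs7]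
  have hSge4 : 3456 * a * ((a : ℝ) ^ 2 + 2 * a + 2 * h.natAbs) * Hp ^ 2 / ε' ≤ logWeightSum x ω := by
    rw [hS₀] at hSS₀; linarith only [hSS₀, hs1, hs2, hs3, hs4, hs5, hs6, hs7]
  have hSge5 : 512 * (a : ℝ) ^ 3 * (6 + 3 * (h.natAbs : ℝ)) * CΞ * ε₁⁻¹ ^ 10 * Hp ^ 8 *
      (8 + 2 * Real.log a) / ε' ≤ logWeightSum x ω := by rw [hS₀] at hSS₀; linarith only [hSS₀, hs1, hs2, hs3, hs4, hs5, hs6, hs7]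
  have hSge6 : 4 * a * (8 + 2 * Real.log a + 4 * ((b / a : ℤ).natAbs : ℕ)) / ε' ≤ logWeightSum x ω := by
    rw [hS₀] at hSS₀; linarith only [hSS₀, hs1, hs2, hs3, hs4, hs5, hs6, hs7]
  have hxω7 : (((b / a : ℤ).natAbs : ℕ) : ℝ) + h.natAbs + b.natAbs + 2 ≤ x / ω := by
    rw [hS₀] at hxωS; linarith only [hxωS, hs1, hs2, hs3, hs4, hs5, hs6, hs7]
  -- normalising `gᵢ(0) = 0`
  set g₁' : ℕ → ℂ := Function.update g₁ 0 0 with hg₁'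
  set g₂' : ℕ → ℂ := Function.update g₂ 0 0 with hg₂'
  have hcm₁' := update_zero_mul hcm₁
  have hcm₂' := update_zero_mul hcm₂
  have hS₁' := update_zero_unimod hS₁
  have hS₂' := update_zero_unimod hS₂
  have hb₁' := update_zero_bound hS₁
  have hb₂' := update_zero_bound hS₂
  rw [← hg₁'] at hcm₁' hS₁' hb₁'
  rw [← hg₂'] at hcm₂' hS₂' hb₂'
  -- the range in `n`: `an + b ≥ 1`, `an + b + h ≥ 1`
  have hnlow : ∀ n ∈ Ioc ⌊x / ω⌋₊ ⌊x⌋₊, (h.natAbs : ℤ) + b.natAbs + 2 ≤ n := by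
    intro n hn
    have h1 := (mem_Ioc.1 hn).1
    have h2 : x / ω < (⌊x / ω⌋₊ : ℝ) + 1 := Nat.lt_floor_add_one _
    have h3 : ((h.natAbs : ℕ) : ℝ) + b.natAbs + 2 < (n : ℝ) := by
      have : ((⌊x / ω⌋₊ : ℕ) : ℝ) + 1 ≤ n := by exact_mod_cast h1
      have h0 : (0 : ℝ) ≤ ((b / a : ℤ).natAbs : ℕ) := Nat.cast_nonneg _
      linarith only [this, h2, hxω7, h0]
    have h4 : (h.natAbs : ℤ) + b.natAbs + 2 < n := by exact_mod_cast h3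
    omega
  have hsum : ∑ n ∈ Ioc ⌊x / ω⌋₊ ⌊x⌋₊,
      g₁ ((a : ℤ) * n + b).toNat * g₂ ((a : ℤ) * n + b + h).toNat / (n : ℂ) =
      ∑ n ∈ Ioc ⌊x / ω⌋₊ ⌊x⌋₊,
        g₁' ((a : ℤ) * n + b).toNat * g₂' ((a : ℤ) * n + b + h).toNat / (n : ℂ) := by
    refine sum_congr rfl fun n hn => ?_
    have h1 := hnlow n hn
    have hb0 : (b.natAbs : ℤ) = |b| := Int.natCast_natAbs b
    have hh0 : (h.natAbs : ℤ) = |h| := Int.natCast_natAbs h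
    have hab : |b| ≥ -b := neg_le_abs b
    have hah : |h| ≥ -h := neg_le_abs h
    have han : (n : ℤ) ≤ (a : ℤ) * n :=
      le_mul_of_one_le_left (by positivity) (by exact_mod_cast ha)
    have h2 : 1 ≤ ((a : ℤ) * n + b).toNat := by omega
    have h3 : 1 ≤ ((a : ℤ) * n + b + h).toNat := by omega
    rw [hg₁', hg₂', Function.update_of_ne (by omega), Function.update_of_ne (by omega)]
  have hbpos : ∀ n ∈ Ioc ⌊x / ω⌋₊ ⌊x⌋₊, 0 ≤ (a : ℤ) * n + b := by
    intro n hn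
    have h1 := hnlow n hn
    have hb0 : (b.natAbs : ℤ) = |b| := Int.natCast_natAbs b
    have hab : |b| ≥ -b := neg_le_abs b
    have han : (n : ℤ) ≤ (a : ℤ) * n :=
      le_mul_of_one_le_left (by positivity) (by exact_mod_cast ha)
    omega
  -- reduce to `ε'` and argue by contradiction
  suffices hmain : ‖∑ n ∈ Ioc ⌊x / ω⌋₊ ⌊x⌋₊,
      g₁' ((a : ℤ) * n + b).toNat * g₂' ((a : ℤ) * n + b + h).toNat / (n : ℂ)‖ ≤ ε' * Real.log ω by
    rw [hsum]
    exact hmain.trans (mul_le_mul_of_nonneg_right hε'ε hlogω0)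
  by_contra hcon
  push Not at hcon
  -- (2.14): `|𝔼 1_{𝐧≡b (a)} g₁ g₂(·+h)| ≥ ε'/(4a)`
  have hk : (((b / a : ℤ).natAbs : ℕ) : ℝ) ≤ x / ω := by
    have h0 : (0 : ℝ) ≤ h.natAbs := Nat.cast_nonneg _
    have h0' : (0 : ℝ) ≤ b.natAbs := Nat.cast_nonneg _
    linarith only [hxω7, h0, h0']
  have hX₀ := corrInd_lower_bound hb₁' hb₂' ha b h hS hk hbpos
  have hX : ε' / (4 * a) ≤ ‖logAvg (corrInd a b h g₁' g₂') x ω‖ := by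
    set T := ‖∑ n ∈ Ioc ⌊x / ω⌋₊ ⌊x⌋₊,
      g₁' ((a : ℤ) * n + b).toNat * g₂' ((a : ℤ) * n + b + h).toNat / (n : ℂ)‖ with hT
    have h1 : ε' * (logWeightSum x ω - 1) ≤ T := by
      have : ε' * (logWeightSum x ω - 1) ≤ ε' * Real.log ω :=
        mul_le_mul_of_nonneg_left (by linarith only [hShi]) hε'0.le
      linarith only [this, hcon]
    -- `T/(aS) ≥ ε'/a - ε'/(aS) ≥ ε'/a - ε'/(2a)`
    have h2 : ε' / a - ε' / (2 * a) ≤ T / (a * logWeightSum x ω) := by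
      rw [le_div_iff₀ (by positivity)]
      have e : (ε' / a - ε' / (2 * a)) * (a * logWeightSum x ω) = ε' * logWeightSum x ω / 2 := by
        field_simp; ring
      rw [e]
      have hmul2 : ε' * 2 ≤ ε' * logWeightSum x ω := mul_le_mul_of_nonneg_left hS2 hε'0.le
      linarith only [h1, hmul2]
    have h3 : (8 + 2 * Real.log a + 4 * ((b / a : ℤ).natAbs : ℕ)) / logWeightSum x ω ≤ ε' / (4 * a) := by
      rw [div_le_div_iff₀ hS (by positivity)]
      have := (div_le_iff₀ hε'0).1 hSge6
      linarith only [this]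
    have e4 : ε' / a - ε' / (2 * a) - ε' / (4 * a) = ε' / (4 * a) := by field_simp; ring
    linarith only [hX₀, h2, h3, e4]
  -- the good scale
  have hsmall : (Hp : ℝ) * (NV * (3 * Real.sqrt (4 * Hp / logWeightSum x ω))) ≤ 1 := by
    have hy0 : 0 ≤ 4 * (Hp : ℝ) / logWeightSum x ω := by positivity
    have hsq : Real.sqrt (4 * Hp / logWeightSum x ω) ≤ 1 / (3 * Hp * NV) := by
      rw [Real.sqrt_le_left (by positivity), div_le_iff₀ hS]
      have e : (1 / (3 * (Hp : ℝ) * NV)) ^ 2 * logWeightSum x ω = logWeightSum x ω / (9 * Hp ^ 2 * NV ^ 2) := by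
        field_simp; ring
      rw [e, le_div_iff₀ (by positivity)]
      calc 4 * (Hp : ℝ) * (9 * Hp ^ 2 * NV ^ 2) = 36 * Hp ^ 3 * NV ^ 2 := by ring
        _ ≤ logWeightSum x ω := hSge2
    calc (Hp : ℝ) * (NV * (3 * Real.sqrt (4 * Hp / logWeightSum x ω)))
        ≤ (Hp : ℝ) * (NV * (3 * (1 / (3 * Hp * NV)))) := by gcongr
      _ = 1 := by field_simp
  have hsmall' : (Hp : ℝ) * (((#(meshAlphabet (ε₁ ^ 2) ×ˢ meshAlphabet (ε₁ ^ 2)) ^ Hp * 4 ^ Hp : ℕ) : ℝ) *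
      (3 * Real.sqrt (4 * Hp / logWeightSum x ω))) ≤ 1 := by rw [← hNV]; exact hsmall
  obtain ⟨H, hHmH, hHHp, hadvd, h16, hI⟩ :=
    hgood Hp (le_max_right _ _) ε₁ hε₁ hε₁1 x ω hS hSge1 hsmall' g₁' g₂' hb₁' hb₂'
  -- the conditions at `H`
  have hNH : N ≤ H := hHmN.trans hHmH
  obtain ⟨hK₀H, ⟨-, hσ⟩, hXiH, hllH⟩ := hN H hNH
  have hHR : (16 : ℝ) ≤ H := by exact_mod_cast h16
  have hH0 : (0 : ℝ) < H := by linarith only [hHR]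
  have hHpR : (H : ℝ) ≤ Hp := by exact_mod_cast hHHp
  have hL1 : 1 ≤ Real.log H := by
    rw [← Real.log_exp 1]
    refine Real.log_le_log (Real.exp_pos 1) ?_
    have := Real.exp_one_lt_d9
    linarith only [this, hHR]
  have hL0 : 0 < Real.log H := by linarith only [hL1]
  have hHL0 : 0 < (H : ℝ) / Real.log H := by positivity
  -- unpack `K₀ ≤ H`
  have hp7 : (0 : ℝ) ≤ 16 * (2 / ε₁ ^ 7) ^ 2 + 16 := by positivity
  have hp10 : (0 : ℝ) ≤ 16 * (2 / ε₁ ^ 10) ^ 2 + 16 := by positivity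
  have hp13 : (0 : ℝ) ≤ 16 * (1 / ε₁ ^ 13) ^ 2 + 16 := by positivity
  have hp4 : (0 : ℝ) ≤ 4 / ε₁ ^ 4 := by positivity
  have hp2 : (0 : ℝ) ≤ 2 * a / ε₁ ^ 2 + 1 := by positivity
  have hp384 : (0 : ℝ) ≤ 384 * a ^ 3 / ε' := by positivity
  have hT7 : 16 * (2 / ε₁ ^ 7) ^ 2 + 16 ≤ (H : ℝ) := by rw [hK₀] at hK₀H; linarith only [hK₀H, hp7, hp10, hp13, hp4, hp2, hp384]
  have hT10 : 16 * (2 / ε₁ ^ 10) ^ 2 + 16 ≤ (H : ℝ) := by rw [hK₀] at hK₀H; linarith only [hK₀H, hp7, hp10, hp13, hp4, hp2, hp384]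
  have hT13 : 16 * (1 / ε₁ ^ 13) ^ 2 + 16 ≤ (H : ℝ) := by rw [hK₀] at hK₀H; linarith only [hK₀H, hp7, hp10, hp13, hp4, hp2, hp384]
  have hT4 : 4 / ε₁ ^ 4 ≤ (H : ℝ) := by rw [hK₀] at hK₀H; linarith only [hK₀H, hp7, hp10, hp13, hp4, hp2, hp384]
  have hT2 : 2 * a / ε₁ ^ 2 + 1 ≤ (H : ℝ) := by rw [hK₀] at hK₀H; linarith only [hK₀H, hp7, hp10, hp13, hp4, hp2, hp384]
  have hT384 : 384 * a ^ 3 / ε' ≤ (H : ℝ) := by rw [hK₀] at hK₀H; linarith only [hK₀H, hp7, hp10, hp13, hp4, hp2, hp384]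
  have hH4 : 4 ≤ ε₁ ^ 4 * H := by
    have := (div_le_iff₀ (by positivity : (0 : ℝ) < ε₁ ^ 4)).1 hT4; linarith only [this]
  have hH7 : 2 ≤ ε₁ ^ 7 * H / Real.log H := by
    have h1 := Numeric.le_div_log_of_sq_le (by positivity : (0 : ℝ) ≤ 2 / ε₁ ^ 7) hT7
    have h2 : ε₁ ^ 7 * H / Real.log H = ε₁ ^ 7 * (H / Real.log H) := by ring
    rw [h2]
    have h3 : (2 : ℝ) = ε₁ ^ 7 * (2 / ε₁ ^ 7) := by field_simp
    rw [h3]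
    exact mul_le_mul_of_nonneg_left h1 (by positivity)
  have hH10 : 2 * Real.log H ≤ ε₁ ^ 10 * H := by
    have h1 := Numeric.le_div_log_of_sq_le (by positivity : (0 : ℝ) ≤ 2 / ε₁ ^ 10) hT10
    rw [le_div_iff₀ hL0, div_mul_eq_mul_div, div_le_iff₀ (by positivity)] at h1
    linarith only [h1]
  have hH13 : Real.log H ≤ ε₁ ^ 13 * H := by
    have h1 := Numeric.le_div_log_of_sq_le (by positivity : (0 : ℝ) ≤ 1 / ε₁ ^ 13) hT13
    rw [le_div_iff₀ hL0, div_mul_eq_mul_div, div_le_iff₀ (by positivity)] at h1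
    linarith only [h1]
  have haε : (a : ℝ) < ε₁ ^ 2 * H / 2 := by
    have h1 : 2 * a / ε₁ ^ 2 < (H : ℝ) := by linarith only [hT2]
    rw [div_lt_iff₀ hδ] at h1
    rw [lt_div_iff₀ (by norm_num : (0 : ℝ) < 2)]
    linarith only [h1]
  have hHε : 384 * (a : ℝ) ^ 3 ≤ ε' * H := by
    have := (div_le_iff₀ hε'0).1 hT384; linarith only [this]
  have haH : a ≤ H := hHma.trans hHmH
  -- `|Ξ_H|`
  have hc : ∀ p ∈ primesP ε₁ H, ‖cCoeff g₁' g₂' p‖ ≤ 1 := fun p _ => norm_cCoeff_le hb₁' hb₂' p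
  have hXi := hXiH hadvd (cCoeff g₁' g₂') hc
  -- `(log log H)^9`
  have hll : (6 + 3 * (h.natAbs : ℝ)) * CΞ * a ^ 2 * ε₁⁻¹ ^ 10 * (2 * Cp) *
      Real.log (Real.log H) ^ 9 ≤ ε' / (512 * a) * Real.log H := by
    rw [← hK]
    have h1 : K * Real.log (Real.log H) ^ 9 ≤ K * (c₉ * Real.log H) :=
      mul_le_mul_of_nonneg_left hllH hK0
    have h2 : K * c₉ ≤ ε' / (512 * a) := by
      have e : K * c₉ = ε' / (512 * a) * (K / (K + 1)) := by rw [hc₉]; field_simp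
      rw [e]
      exact mul_le_of_le_one_right (by positivity) (div_le_one_of_le₀ (by linarith only) (by positivity))
    calc K * Real.log (Real.log H) ^ 9 ≤ K * (c₉ * Real.log H) := h1
      _ = K * c₉ * Real.log H := by ring
      _ ≤ ε' / (512 * a) * Real.log H := mul_le_mul_of_nonneg_right h2 hL0.le
  -- `S`-conditions
  have hS3 : 3456 * a * ((a : ℝ) ^ 2 + 2 * a + 2 * h.natAbs) * (Hp : ℝ) ^ 2 ≤ ε' * logWeightSum x ω := by
    have := (div_le_iff₀ hε'0).1 hSge4; linarith only [this]
  have hS4 : 512 * (a : ℝ) ^ 3 * (6 + 3 * (h.natAbs : ℝ)) * CΞ * ε₁⁻¹ ^ 10 * (Hp : ℝ) ^ 8 *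
      (8 + 2 * Real.log a) ≤ ε' * logWeightSum x ω := by
    have := (div_le_iff₀ hε'0).1 hSge5; linarith only [this]
  have hrange : (h.natAbs : ℝ) + 1 ≤ x / ω := by
    have h0 : (0 : ℝ) ≤ ((b / a : ℤ).natAbs : ℕ) := Nat.cast_nonneg _
    have h0' : (0 : ℝ) ≤ b.natAbs := Nat.cast_nonneg _
    linarith only [hxω7, h0, h0']
  -- `η` and (3.9)
  have hP := prod_primesP_pos ε₁ H
  have hPle : ∏ p ∈ primesP ε₁ H, p ≤ 4 ^ Hp := by
    refine (prod_primesP_le_four_pow ε₁ H).trans (Nat.pow_le_pow_right (by norm_num) ?_)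
    refine le_trans ?_ hHHp
    have h3 : ε₁ ^ 2 * (H : ℝ) ≤ H :=
      mul_le_of_le_one_left (Nat.cast_nonneg _) (pow_le_one₀ hε₁.le hε₁1)
    exact Nat.floor_le_of_le (by exact_mod_cast h3)
  obtain ⟨-, h82, hη1⟩ := Numeric.eta_le_one hP hPle hSge3
  have hent := log_sub_le_ent_mod hP hS h82 (x := x) (ω := ω)
  have hη0 : 0 ≤ ((∏ p ∈ primesP ε₁ H, p : ℕ) : ℝ) *
      (negMulLog ((8 + 2 * Real.log ((∏ p ∈ primesP ε₁ H, p : ℕ) : ℝ)) / logWeightSum x ω) +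
        (8 + 2 * Real.log ((∏ p ∈ primesP ε₁ H, p : ℕ) : ℝ)) / logWeightSum x ω) := by
    have hu0 : 0 ≤ (8 + 2 * Real.log ((∏ p ∈ primesP ε₁ H, p : ℕ) : ℝ)) / logWeightSum x ω := by
      have : 0 ≤ Real.log ((∏ p ∈ primesP ε₁ H, p : ℕ) : ℝ) :=
        Real.log_nonneg (by exact_mod_cast hP)
      positivity
    have hu1 : (8 + 2 * Real.log ((∏ p ∈ primesP ε₁ H, p : ℕ) : ℝ)) / logWeightSum x ω ≤ 1 := by
      rw [div_le_one hS]; exact h82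
    exact mul_nonneg (Nat.cast_nonneg _) (add_nonneg (negMulLog_nonneg hu0 hu1) hu0)
  -- (2.10) for `g₁'` with `Cp`
  have h210' : ∀ α : ℝ, logAvgShortExpSum g₁' x ω H α ≤
      Cp * (Real.log (Real.log H) / Real.log H) * Real.log ω := by
    intro α
    rw [hg₁', logAvgShortExpSum_update_zero]
    refine (h210 H hHmH hHHp α).trans ?_
    have h0 : 0 ≤ Real.log (Real.log H) / Real.log H * Real.log ω := by
      have := Real.log_nonneg hL1; positivity
    calc C * (Real.log (Real.log H) / Real.log H) * Real.log ω
        = C * (Real.log (Real.log H) / Real.log H * Real.log ω) := by ring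
      _ ≤ Cp * (Real.log (Real.log H) / Real.log H * Real.log ω) :=
          mul_le_mul_of_nonneg_right hCCp h0
      _ = Cp * (Real.log (Real.log H) / Real.log H) * Real.log ω := by ring
  have hωS : Real.log ω ≤ logWeightSum x ω + 1 := by linarith only [hSlo]
  exact scale_contradiction hcm₁' hcm₂' hS₁' hS₂' hb₁' hb₂' ha b h hε'0 hε₁ hε₁0 hε₁ε hCΞ hCp0
    hHHp h16 haH hadvd hH4 hH7 hH10 hH13 haε hHε hσ hXi hll hS hS2 hωS hlogω0 hrange hS3 hS4
    hη0 hη1 hent hI hX h210'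

end Tao2016

end Literature.NumberTheory.LFunctions
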